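import Literature.NumberTheory.LFunctions.CertifiedZetaIsolationAliasingSums
import HarnessLib

/-!
# Platt 2017, *Isolating some non-trivial zeros of zeta*, §3 step (5): Lemma 3.2 — the `j`-series
# for the Fourier transform `F` of the windowed `Λ` (shift across the pole of `ζ`, expand `ζ(s) = Σ j^{−s}`,
# interchange, shift back); the reality of `Λ` (`F(−x) = conj F(x)`) and with it Lemmas A.8, A.9, C.1
# of Appendix A/C AS PRINTED (unconditional); Lemma A.6 two-sided with an honest constant and Lemma A.7;
# Lemma B.2 (the Taylor tail of `G`) AS PRINTED; display (3.2) (Lemma 3.3) in its truncated form and the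
# assembled step-(5) error budget (3.2 + B.1 + (2√J−1)·B.2);
# Theorem 5.1 (the certified output) as a named fact

Topic `Literature/NumberTheory/LFunctions`; namespace `Literature.NumberTheory.LFunctions`, engine
sub-namespace `Platt2017`. Source: D. J. Platt, *Isolating some non-trivial zeros of zeta*, Math. Comp.
**86** (2017), no. 307, 2449–2467 [Platt2017] (journal pdf held as
`paper:platt2017-isolating-some-non-trivial-zeros-zeta`; §3 pp. 2451–2453). Third module of the typing
of this paper, after `CertifiedZetaIsolationBounds.lean` (Appendix A Gamma side, A.5/A.10/A.11, B.2,
C.2/C.3) and `CertifiedZetaIsolationAliasingSums.lean` (A.6, A.7, A.8, A.9, B.1, C.1; both files are at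
the proposal size limit). Typed for the parity-realchar cell (D-0088 (4) literature-typing layer, row
«Platt 2016 / Platt–Trudgian 2021 / Booker 2006»: instrument provenance of `platt_trudgian_numerical_rh`).
Everything here is PROVED except the paper's certified computational output, Theorem 5.1, recorded as
the one named fact `platt2017_theorem51` (instrument provenance for `platt_trudgian_numerical_rh`).

## The statement (p. 2453, verbatim) and what is proved

Step (5) of the algorithm (p. 2451) computes `F(m/B)`, `F(x) := ∫ f(t) e(−tx) dt` the Fourier transform
of `f(t) = Λ(t+t₀) exp(π(t+t₀)/4 − t²/(2h²))` ((3.1); `Λ(t) = π^{−it/2} Γ((1/2+it)/2) ζ(1/2+it)`,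
`e(x) = e^{2πix}`), from `G(u) := ∫ g(t;0) e(−tu) dt`, `g(t;0) = Γ((1/2+i(t+t₀))/2) e^{π(t+t₀)/4 − t²/(2h²)}`
(step (3)). «The meat of step (5) is the following two lemmas.

**Lemma 3.2.** Let `F` be the Fourier transform of `f`. Then
`|F(x) − Σ_{j=1}^{∞} (1/√j) (j√π)^{−it₀} G(x + log(j√π)/(2π))| = 2π^{5/4} exp(1/(8h²) − t₀²/(2h²) − πx)`.
*Proof.* We start with `F(x) = ∫ f(t) e(−tx) dt` and substitute `s = 1/2 + i(t+t₀)`. We then shift the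
line of integration right to `ℜ(s) = σ > 1` picking up the simple pole of `ζ(s)` with residue `1` at
`s = 1`. Now write `ζ(s)` as a sum (over `j`), interchange the sum and integral and move the line of
integration back to `1/2`. □»

— `platt2017_lemma32`: **PROVED for every `x ≥ 0`, `h > 0`, `t₀ ∈ ℝ`, exactly as printed (an
EQUALITY of the modulus), together with the convergence of the series** (summed over `j ∈ ℕ`; the
`j = 0` term is `0` since `1/√0 = 0` in Mathlib). The proof is the printed one with `σ = 3`:
`Platt2017.fourierF_line_shift` (the shift of `∫ Ξ` from `Re s = 1/2` to `Re s = 3` across the simple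
pole of `Λ(s) = π^{−s/2}Γ(s/2)ζ(s)` at `1` — the tree's strip residue theorem, with the engine of
`platt2017_lemmaA8`), `Platt2017.zeta_term_eq` / `fourierF_kernel_eq_tsum` («write ζ(s) as a sum»:
Mathlib `zeta_eq_tsum_one_div_nat_cpow`; the `j`-th term of the continued integrand is
`(1/√j)(j√π)^{−it₀} · Ψ₀(s; u_j)`, `u_j = x + log(j√π)/(2π)`, `Ψ₀(·; u)` the continued integrand of
`G(u)` — the factor `π^{1/4}(j√π)^{−s}` is absorbed into the Fourier variable),
`Platt2017.integral_norm_zeta_term_le` (`∫|T_j(3+iy)| dy ≤ e^{25/(8h²)} C(3,t₀,h,0) j^{−3}`, so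
Mathlib's `integral_tsum_of_summable_integral_norm` interchanges sum and integral) and
`Platt2017.integral_zeta_term` (each term moved back to `Re s = 1/2` by the pole-free shift
`Platt2017.integral_fourier_kernel_shift` and recognised as `(1/√j)(j√π)^{−it₀} G(u_j)` by
`Platt2017.fourier_kernel_eq`); the right-hand side is `Platt2017.norm_fourierF_residue`.
NOT typed here: Lemma 3.2 for `x < 0`. Lemma 3.3 / display (3.2) («`F(x) = Σ_{k≥0} Σ_m
G^{(k)}(x+u_m)/k! S^{(k)}_m` … This is a simple application of Taylor's theorem») is typed in the
TRUNCATED form the algorithm uses (p. 2464: the `j > J` tail is Lemma B.1, the order-`K` Taylor tail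
Lemma B.2 «`J` times, weighted by `1/√j`», i.e. `× (2√J − 1)`): `platt2017_eq32_taylor_truncation`
(‖Σ_{j≤J} (1/√j)(j√π)^{−it₀}[G(x+L_j) − Σ_{k<K} G^{(k)}(x+v_j)(L_j−v_j)^k/k!]‖ ≤ (2√J−1) ·
2^{(K+5)/2}π^{K+1/2}h^{K+1}ξ^K/Γ((K+2)/2)` whenever `|L_j − v_j| ≤ ξ`) and `platt2017_eq32_regroup` (the
finite regrouping by bucket, `Σ_j Σ_k = Σ_k Σ_m G^{(k)}(x+u_m)/k! · S^{(k)}_m`); the infinite double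
series (3.2) itself is not asserted. **`platt2017_step5_error_budget`** assembles step (5) as used:
`|F(x) − Σ_{k<K} Σ_m G^{(k)}(x+u_m)/k! S^{(k)}_{m,J}| ≤ [Lemma 3.2] + [Lemma B.1] + (2√J−1)·[Lemma B.2]`.

## The reality of `Λ` and the printed forms of Lemmas A.8, A.9, C.1

«`Λ(t) = π^{−it/2} Γ((1/2+it)/2) ζ(1/2+it)` which, by the functional equation for `ζ`, is real-valued»
(p. 2451): `Platt2017.Lambda_eq_completedZeta` (`Λ(u) = π^{1/4} Λ_Mathlib(1/2+iu)`),
`Platt2017.conj_Lambda` (`conj Λ(u) = Λ(u)`, from Mathlib's `completedRiemannZeta_one_sub` and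
`conj Λ_Mathlib(s) = Λ_Mathlib(conj s)` — `riemannZeta_conj`, `Complex.Gamma_conj`, `Complex.cpow_conj`),
hence `Platt2017.fourierF_neg`: **`F(−x) = conj F(x)`** («Since `f(t)` is real …», proof of Lemma A.8).
Consequently:
* `platt2017_lemmaA8_abs` — **Lemma A.8 (p. 2461) AS PRINTED, every real `x`** (`|x|` in the exponents;
  `σ = 2m+1 ≥ 3`): `x ≥ 0` is `platt2017_lemmaA8` (sibling file), `x < 0` by `F(−x) = conj F(x)`.
* `platt2017_lemmaA9` — **Lemma A.9 (p. 2462) AS PRINTED** (the aliasing error of step (6),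
  `‖Σ_{l≠0} F(x + lA)‖ ≤ 2ζ(σ)π^{(1−2σ)/4} C(σ,t₀,h,0) e^{(2σ−1)²/(8h²) − Aπ(2σ−1)/2}(1 + 1/(Aπ(2σ−1)))
  + 4π^{5/4} e^{(1−4t₀²)/(8h²) − Aπ/2}(1 + 1/(Aπ))`, `|x| ≤ A/2`): `platt2017_lemmaA9_of_bound` fed with
  `platt2017_lemmaA8_abs`.
* `platt2017_lemmaC1` — **Lemma C.1 (p. 2464) AS PRINTED** (`I = 4∫_{A/2}^∞ |∫ W(t)e(−xt) dt| dx ≤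
  4ζ(σ)/(2σ−1) π^{(−3−2σ)/4} C(σ,t₀,H,0) e^{(2σ−1)²/(8H²) − πA(2σ−1)/2} + 8π^{1/4} e^{(1−4t₀²)/(8H²) − πA/2}`,
  the constant written `4ζ(σ)π^{(1−2σ)/4}C/((2σ−1)π)`): `Platt2017.norm_fourierW_eq` («the substitution
  `t → t + t₀`»: the inner integral is `e(−xt₀) F_H(x)`), `platt2017_lemmaC1_of_bound` and
  `platt2017_lemmaA8_abs` with `H` for `h`.

## Lemma A.6 two-sided, Lemma A.7, and the chain of Lemma B.2

* `platt2017_lemmaA6` — Lemma A.6 (p. 2460) in its printed two-sided shape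
  `|G^{(k)}(u)| ≤ C e^{(2σ+1)²/(8h²) − (2σ−1)π|u|} + 2^{k+2}π^{k+1}e^{−t₀²/(2h²)} Σ_l (…) e^{(4l+1)²/(8h²) − (4l+1)π|u|}`
  for every real `u`, PROVED with the honest constant `C = max(C₊, C₋)` (`C₊`, `C₋` the right- and left-shift
  integrals of `platt2017_lemmaA6_right` / `_left`) in place of Platt's `C(σ,t₀,h,k)` — the printed
  identification of the two rests on the closing sentence «`|Γ(−σ/2+it)| < |Γ(σ/2+it)|`», false at
  small `|t|`; hence `platt2017_lemmaA7` — **Lemma A.7 (pp. 2460–2461), the aliasing error of step (4),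
  unconditional** with the same constant (`platt2017_lemmaA7_of_bound` fed with `platt2017_lemmaA6`).
* `platt2017_lemmaB2` — **Lemma B.2 (p. 2464) AS PRINTED: for `|w| ≤ ξ`,
  `|Σ_{k≥K} G^{(k)}(u) w^k/k!| = |G(u+w) − Σ_{k<K} G^{(k)}(u) w^k/k!| ≤ 2^{K+5/2}π^{K+1/2}h^{K+1}ξ^K/Γ((K+2)/2)`**
  (the Taylor tail written as `G(u+w)` minus the Taylor polynomial, `G^{(k)}(u) = ∫ g(t;k)e(−tu) dt`):
  the sharp remainder `|e^{iθ} − Σ_{k<K}(iθ)^k/k!| ≤ |θ|^K/K!` (proved here by induction, integrating the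
  previous case) inside the Fourier integral, Lemma A.4 (`Platt2017.norm_Gamma_half_line_mul_exp_lt_four`)
  and the moment/duplication computation `platt2017_lemmaB2_of_bound`; `platt2017_lemmaB2_tail` is the
  printed intermediate `sup_{u'} |G^{(K)}(u')| ξ^K/K! ≤ …` on its own; **`platt2017_lemmaB2_printed`**
  (with `platt2017_lemmaB2_of_bound_printed`) carries the PRINTED constant `2^{(K+5)/2}` — the exact value
  the duplication formula gives (`platt2017_lemmaB2_duplication`, first half); the sibling file's
  `_of_bound` stops at the weaker `2^{K+5/2}`.

With this, of Platt's Appendices A–C every lemma is a theorem of the tree except: the closing sentence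
of A.6 (false as printed at small `|t|`) — so A.6/A.7 carry `max(C₊,C₋)` for `C(σ,t₀,h,k)` — and A.3,
which holds in its corrected form only (`platt2017_lemmaA3_corrected`); of §§3–4, Lemma 3.3 (the bucketed
Taylor rearrangement (3.2)) is not typed; Theorems 4.1/4.2 (Turing's method, Trudgian's `∫S`) are the
tree's `TuringMethod.lean`, Theorems 4.3/4.4 (Whittaker–Shannon, Weiss) its
`CertifiedLFunctionUpsampling.lean` (Platt 2016, Theorems 8.1/8.2, proved).

## Theorem 5.1 (named fact)

* `platt2017_theorem51` — «Let `ρ` be a non-trivial zero of the Riemann zeta function with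
  `|ℑρ| ≤ 3.0610046 × 10¹⁰`. Then `ρ` is simple and `ℜρ = 1/2`.» (p. 2456; 103 800 788 359 zeros isolated
  to `±2^{−102}`, completeness by Turing's method): a certified computation, stated as a `Prop` with
  cite; proved corollaries `platt2017_theorem51.rh_upTo` (the shape of `platt_trudgian_numerical_rh`,
  height `30 610 046 000`) and `platt2017_theorem51.simple`.

## Main results

* `platt2017_lemma32`; engine `Platt2017.fourierF_line_shift`, `zeta_term_eq`, `fourierF_kernel_eq_tsum`,
  `integral_zeta_term`, `integral_norm_zeta_term_le`.
* `platt2017_lemmaA8_abs`, `platt2017_lemmaA9`, `platt2017_lemmaC1`; engine `Platt2017.Lambda_eq_completedZeta`,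
  `conj_Lambda`, `fourierF_integrand_conj`, `fourierF_neg`, `norm_fourierW_eq`.
* `platt2017_lemmaA6`, `platt2017_lemmaA7`, `platt2017_lemmaB2_tail`, `platt2017_lemmaB2`.
* named fact `platt2017_theorem51` (+ `.rh_upTo`, `.simple`).
* `platt2017_lemmaB2_of_bound_printed`, `platt2017_lemmaB2_printed` (B.2 with the printed `2^{(K+5)/2}`).
* `platt2017_eq32_taylor_truncation`, `platt2017_eq32_regroup` ((3.2) truncated), `platt2017_step5_error_budget`.

## References

* [Platt2017] D. J. Platt, *Isolating some non-trivial zeros of zeta*, Math. Comp. 86 (2017), no. 307,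
  2449–2467, doi:10.1090/mcom/3198 — §3 pp. 2451–2453 (steps (1)–(8), Lemmas 3.2, 3.3, (3.2)); Appendix A,
  Lemma A.6 p. 2460, Lemma A.7 pp. 2460–2461, Lemma A.8 p. 2461, Lemma A.9 p. 2462; Appendix B,
  Lemma B.2 p. 2464; Appendix C, Lemma C.1 p. 2464; §5, Theorem 5.1 p. 2456.
* [PlattTrudgian2021] D. J. Platt, T. S. Trudgian, *The Riemann hypothesis is true up to 3·10¹²*,
  Bull. Lond. Math. Soc. 53 (2021), 792–797, Theorem 1 (the tree's `platt_trudgian_numerical_rh`).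
* E. C. Titchmarsh, *The Theory of the Riemann Zeta-Function*, 2nd ed., §2.1 (`ζ(s) = Σ n^{−s}`,
  `Λ = Λ₀ − 1/s − 1/(1−s)`), via Mathlib's `riemannZeta` / `completedRiemannZeta`.
-/

noncomputable section

open Complex Real Set MeasureTheory Filter
open scoped ComplexConjugate

namespace Literature.NumberTheory.LFunctions

namespace Platt2017

/-! ### Lemma 3.2: the `j`-series for `F` -/

/-- **The shift of `F`'s integral across the pole** (the first half of the proofs of Lemma A.8 and
Lemma 3.2: «We write `s = 1/2 + i(t+t₀)` and shift the line of integration right to `ℜ(s) = σ`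
encountering the pole of `ζ(s)` at `s = 1`»): for `σ ≥ 3/2`, `h > 0`, `x ≥ 0`,
`∫ Ξ(1/2+iy) dy = ∫ Ξ(σ+iy) dy − 2π φ(1)`. [cite: Platt2017, Lemma A.8 p. 2461 (proof); Lemma 3.2 p. 2453 (proof)] -/
theorem fourierF_line_shift {σ t₀ h x : ℝ} (hσ : 3 / 2 ≤ σ) (hh : 0 < h) (hx : 0 ≤ x) :
    ∫ y : ℝ, (fun s : ℂ => ((π ^ (1 / 4 : ℝ) : ℝ) : ℂ) * completedRiemannZeta s * Complex.exp (π * (-I * (s - 1 / 2)) / 4) *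
        Complex.exp (-(-I * (s - 1 / 2) - t₀) ^ 2 / (2 * h ^ 2)) *
        Complex.exp (-2 * π * I * (-I * (s - 1 / 2) - t₀) * x)) (((1 / 2 : ℝ) : ℂ) + ((y : ℝ) : ℂ) * I) =
      (∫ y : ℝ, (fun s : ℂ => ((π ^ (1 / 4 : ℝ) : ℝ) : ℂ) * completedRiemannZeta s * Complex.exp (π * (-I * (s - 1 / 2)) / 4) *
        Complex.exp (-(-I * (s - 1 / 2) - t₀) ^ 2 / (2 * h ^ 2)) *
        Complex.exp (-2 * π * I * (-I * (s - 1 / 2) - t₀) * x)) ((σ : ℂ) + ((y : ℝ) : ℂ) * I)) -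
        2 * π * (((π ^ (1 / 4 : ℝ) : ℝ) : ℂ) * (Complex.exp (π * (-I * ((1 : ℂ) - 1 / 2)) / 4) *
          Complex.exp (-(-I * ((1 : ℂ) - 1 / 2) - t₀) ^ 2 / (2 * h ^ 2)) *
          Complex.exp (-2 * π * I * (-I * ((1 : ℂ) - 1 / 2) - t₀) * x))) := by
  set r₁ : ℂ := ((π ^ (1 / 4 : ℝ) : ℝ) : ℂ) * (Complex.exp (π * (-I * ((1 : ℂ) - 1 / 2)) / 4) *
        Complex.exp (-(-I * ((1 : ℂ) - 1 / 2) - t₀) ^ 2 / (2 * h ^ 2)) *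
        Complex.exp (-2 * π * I * (-I * ((1 : ℂ) - 1 / 2) - t₀) * x)) with hr₁
  have hres := Literature.Analysis.Complex.integral_vertical_sub_eq_sum_of_simplePoles
    (F := (fun s : ℂ => ((π ^ (1 / 4 : ℝ) : ℝ) : ℂ) * completedRiemannZeta s * Complex.exp (π * (-I * (s - 1 / 2)) / 4) *
        Complex.exp (-(-I * (s - 1 / 2) - t₀) ^ 2 / (2 * h ^ 2)) *
        Complex.exp (-2 * π * I * (-I * (s - 1 / 2) - t₀) * x)))
    (a := 1 / 2) (b := σ) (by linarith) ({1} : Finset ℂ) (fun _ => r₁) {s : ℂ | 1 / 4 < s.re}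
    (isOpen_lt continuous_const Complex.continuous_re)
    (fun s hs => by
      have h1 : 1 / 2 ≤ s.re := (Set.mem_preimage.mp hs).1
      show 1 / 4 < s.re
      linarith)
    (fun p hp => by
      rw [Finset.mem_singleton] at hp
      subst hp
      simp only [Complex.one_re, Set.mem_Ioo]
      constructor <;> linarith)
    (fun s hs => by
      have h1 : 1 / 4 < s.re := hs.1
      have h2 : s ≠ 1 := fun h => hs.2 (by rw [h]; simp)
      have h0 : s ≠ 0 := fun h => by rw [h] at h1; simp at h1; linarith
      exact (differentiableAt_fourierF_kernel t₀ h x h0 h2).differentiableWithinAt)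
    (fun p hp => by
      rw [Finset.mem_singleton] at hp
      subst hp
      exact fourierF_kernel_pole t₀ h x)
    (integrable_fourierF_kernel_vertical (σ := σ) (t₀ := t₀) hh hx le_rfl (by linarith)
      (by norm_num))
    (integrable_fourierF_kernel_vertical (σ := σ) (t₀ := t₀) hh hx (by linarith) le_rfl
      (by rw [abs_of_pos (by linarith)]; linarith))
    (decay_fourierF_kernel (σ := σ) (t₀ := t₀) hh hx)
  rw [Finset.sum_singleton] at hres
  linear_combination -hres

/-- **«Now write `ζ(s)` as a sum (over `j`)»: the `j`-th term of `Ξ` is Platt's summand.** For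
`j ≥ 1` and any `s`: `π^{1/4} π^{−s/2} Γ(s/2) j^{−s} × (weights at `x`)
= (1/√j)(j√π)^{−it₀} · Ψ₀(s; u = x + log(j√π)/(2π))`, where `Ψ₀(·; u)` is the continued integrand of
`G(u) = G^{(0)}(u)` (`fourier_kernel_eq` with `k = 0`) — i.e. the factor `(j√π)^{−s} π^{1/4}` is
absorbed into the Fourier variable: `u ↦ x + log(j√π)/(2π)`. [cite: Platt2017, Lemma 3.2 p. 2453 (proof)] -/
theorem zeta_term_eq (t₀ h x : ℝ) {n : ℕ} (hn : 1 ≤ n) (s : ℂ) :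
    ((π ^ (1 / 4 : ℝ) : ℝ) : ℂ) * ((π : ℂ) ^ (-s / 2) * Complex.Gamma (s / 2)) *
        Complex.exp (π * (-I * (s - 1 / 2)) / 4) *
        Complex.exp (-(-I * (s - 1 / 2) - t₀) ^ 2 / (2 * h ^ 2)) *
        Complex.exp (-2 * π * I * (-I * (s - 1 / 2) - t₀) * x) * (1 / (n : ℂ) ^ s) =
      (((1 / Real.sqrt (n : ℝ) : ℝ) : ℂ) * (((n : ℝ) * Real.sqrt π : ℝ) : ℂ) ^ (-(I * t₀)) *
      (fun s : ℂ => Complex.Gamma (s / 2) * Complex.exp (π * (-I * (s - 1 / 2)) / 4) *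
        Complex.exp (-(-I * (s - 1 / 2) - t₀) ^ 2 / (2 * h ^ 2)) * (-2 * π * I * (-I * (s - 1 / 2) - t₀)) ^ (0:ℕ) *
        Complex.exp (-2 * π * I * (-I * (s - 1 / 2) - t₀) * ((x + Real.log ((n : ℝ) * Real.sqrt π) / (2 * π)) : ℝ))) s) := by
  have hn0 : (0 : ℝ) < n := by exact_mod_cast hn
  have hnC : (n : ℂ) ≠ 0 := by exact_mod_cast hn0.ne'
  have hπ0 : (0 : ℝ) < π := Real.pi_pos
  have hπC : (π : ℂ) ≠ 0 := by exact_mod_cast hπ0.ne'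
  have hsqπ : 0 < Real.sqrt π := Real.sqrt_pos.mpr hπ0
  have hnπ : 0 < (n : ℝ) * Real.sqrt π := by positivity
  have hnπC : (((n : ℝ) * Real.sqrt π : ℝ) : ℂ) ≠ 0 := by exact_mod_cast hnπ.ne'
  -- every factor as an exponential
  set L : ℝ := Real.log ((n : ℝ) * Real.sqrt π) with hL
  have hLval : L = Real.log n + Real.log π / 2 := by
    rw [hL, Real.log_mul hn0.ne' hsqπ.ne', Real.log_sqrt hπ0.le]
  have f1 : (((π ^ (1 / 4 : ℝ) : ℝ)) : ℂ) = Complex.exp (((Real.log π / 4 : ℝ)) : ℂ) := by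
    rw [Real.rpow_def_of_pos hπ0, Complex.ofReal_exp]; congr 1; push_cast; ring
  have f2 : (π : ℂ) ^ (-s / 2) = Complex.exp (((Real.log π : ℝ) : ℂ) * (-s / 2)) := by
    rw [Complex.cpow_def_of_ne_zero hπC, Complex.ofReal_log hπ0.le]
  have f3 : (1 / (n : ℂ) ^ s : ℂ) = Complex.exp (-(((Real.log n : ℝ) : ℂ) * s)) := by
    rw [Complex.cpow_def_of_ne_zero hnC, ← Complex.ofReal_natCast, ← Complex.ofReal_log hn0.le,
      one_div, ← Complex.exp_neg]
  have f4 : (((1 / Real.sqrt (n : ℝ) : ℝ)) : ℂ) = Complex.exp (((-(Real.log n / 2) : ℝ)) : ℂ) := by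
    rw [Real.sqrt_eq_rpow, Real.rpow_def_of_pos hn0, one_div, ← Real.exp_neg, Complex.ofReal_exp]
    congr 1; push_cast; ring
  have f5 : ((((n : ℝ) * Real.sqrt π : ℝ)) : ℂ) ^ (-(I * t₀)) = Complex.exp (((L : ℝ) : ℂ) * (-(I * t₀))) := by
    rw [Complex.cpow_def_of_ne_zero hnπC, ← Complex.ofReal_log hnπ.le]
  simp only []
  rw [f1, f2, f3, f4, f5, pow_zero, mul_one]
  -- now both sides are `Γ(s/2) ×` products of exponentials
  have key : Complex.exp (((Real.log π / 4 : ℝ)) : ℂ) *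
      (Complex.exp (((Real.log π : ℝ) : ℂ) * (-s / 2)) * Complex.Gamma (s / 2)) *
      Complex.exp (π * (-I * (s - 1 / 2)) / 4) * Complex.exp (-(-I * (s - 1 / 2) - t₀) ^ 2 / (2 * h ^ 2)) *
      Complex.exp (-2 * π * I * (-I * (s - 1 / 2) - t₀) * x) * Complex.exp (-(((Real.log n : ℝ) : ℂ) * s)) =
      Complex.Gamma (s / 2) * Complex.exp (π * (-I * (s - 1 / 2)) / 4) *
        Complex.exp (-(-I * (s - 1 / 2) - t₀) ^ 2 / (2 * h ^ 2)) *
        (Complex.exp (((Real.log π / 4 : ℝ)) : ℂ) * Complex.exp (((Real.log π : ℝ) : ℂ) * (-s / 2)) *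
          Complex.exp (-2 * π * I * (-I * (s - 1 / 2) - t₀) * x) *
          Complex.exp (-(((Real.log n : ℝ) : ℂ) * s))) := by ring
  rw [key]
  have key2 : Complex.exp (((-(Real.log n / 2) : ℝ)) : ℂ) * Complex.exp (((L : ℝ) : ℂ) * (-(I * t₀))) *
      (Complex.Gamma (s / 2) * Complex.exp (π * (-I * (s - 1 / 2)) / 4) *
        Complex.exp (-(-I * (s - 1 / 2) - t₀) ^ 2 / (2 * h ^ 2)) *
        Complex.exp (-2 * π * I * (-I * (s - 1 / 2) - t₀) * ((x + Real.log ((n : ℝ) * Real.sqrt π) / (2 * π) : ℝ) : ℂ))) =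
      Complex.Gamma (s / 2) * Complex.exp (π * (-I * (s - 1 / 2)) / 4) *
        Complex.exp (-(-I * (s - 1 / 2) - t₀) ^ 2 / (2 * h ^ 2)) *
        (Complex.exp (((-(Real.log n / 2) : ℝ)) : ℂ) * Complex.exp (((L : ℝ) : ℂ) * (-(I * t₀))) *
          Complex.exp (-2 * π * I * (-I * (s - 1 / 2) - t₀) * ((x + Real.log ((n : ℝ) * Real.sqrt π) / (2 * π) : ℝ) : ℂ))) := by ring
  rw [key2]
  congr 1
  rw [← Complex.exp_add, ← Complex.exp_add, ← Complex.exp_add, ← Complex.exp_add, ← Complex.exp_add]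
  congr 1
  rw [← hL]
  have hcancel : -2 * (π : ℂ) * I * (-I * (s - 1 / 2) - t₀) * (((x + L / (2 * π) : ℝ)) : ℂ) =
      -2 * π * I * (-I * (s - 1 / 2) - t₀) * x - I * (-I * (s - 1 / 2) - t₀) * L := by
    push_cast
    field_simp
    ring
  rw [hcancel]
  set ℓ : ℝ := Real.log (n : ℝ) with hℓ
  set lp : ℝ := Real.log π with hlp
  rw [hLval]
  have hI : (I : ℂ) ^ 2 = -1 := Complex.I_sq
  push_cast
  linear_combination (-(s - 1 / 2) * ((ℓ : ℂ) + (lp : ℂ) / 2)) * hI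

/-- **`Ξ = Σ_j` (its `j`-th terms) on `Re s > 1`** («Now write `ζ(s)` as a sum (over `j`)»;
Mathlib `zeta_eq_tsum_one_div_nat_cpow`; the `j = 0` term vanishes). [cite: Platt2017, Lemma 3.2 p. 2453 (proof)] -/
theorem fourierF_kernel_eq_tsum (t₀ h x : ℝ) {s : ℂ} (hs : 1 < s.re) :
    (fun s : ℂ => ((π ^ (1 / 4 : ℝ) : ℝ) : ℂ) * completedRiemannZeta s * Complex.exp (π * (-I * (s - 1 / 2)) / 4) *
        Complex.exp (-(-I * (s - 1 / 2) - t₀) ^ 2 / (2 * h ^ 2)) *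
        Complex.exp (-2 * π * I * (-I * (s - 1 / 2) - t₀) * x)) s = ∑' n : ℕ, ((((1 / Real.sqrt (n : ℝ) : ℝ) : ℂ) * (((n : ℝ) * Real.sqrt π : ℝ) : ℂ) ^ (-(I * t₀))) *
      (fun s : ℂ => Complex.Gamma (s / 2) * Complex.exp (π * (-I * (s - 1 / 2)) / 4) *
        Complex.exp (-(-I * (s - 1 / 2) - t₀) ^ 2 / (2 * h ^ 2)) * (-2 * π * I * (-I * (s - 1 / 2) - t₀)) ^ (0:ℕ) *
        Complex.exp (-2 * π * I * (-I * (s - 1 / 2) - t₀) * ((x + Real.log ((n : ℝ) * Real.sqrt π) / (2 * π)) : ℝ))) s) := by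
  have hs0 : s ≠ 0 := fun h0 => by rw [h0] at hs; simp at hs; linarith
  have hΛ : completedRiemannZeta s = (π : ℂ) ^ (-s / 2) * Complex.Gamma (s / 2) * riemannZeta s := by
    rw [riemannZeta_def_of_ne_zero hs0, ← Complex.Gammaℝ_def,
      mul_div_cancel₀ _ (Complex.Gammaℝ_ne_zero_of_re_pos (by linarith))]
  simp only []
  rw [hΛ, zeta_eq_tsum_one_div_nat_cpow hs]
  have hre : ((π ^ (1 / 4 : ℝ) : ℝ) : ℂ) * ((π : ℂ) ^ (-s / 2) * Complex.Gamma (s / 2) * ∑' n : ℕ, 1 / (n : ℂ) ^ s) *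
      Complex.exp (π * (-I * (s - 1 / 2)) / 4) * Complex.exp (-(-I * (s - 1 / 2) - t₀) ^ 2 / (2 * h ^ 2)) *
      Complex.exp (-2 * π * I * (-I * (s - 1 / 2) - t₀) * x) =
      (((π ^ (1 / 4 : ℝ) : ℝ) : ℂ) * ((π : ℂ) ^ (-s / 2) * Complex.Gamma (s / 2)) *
        Complex.exp (π * (-I * (s - 1 / 2)) / 4) * Complex.exp (-(-I * (s - 1 / 2) - t₀) ^ 2 / (2 * h ^ 2)) *
        Complex.exp (-2 * π * I * (-I * (s - 1 / 2) - t₀) * x)) * ∑' n : ℕ, 1 / (n : ℂ) ^ s := by ring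
  rw [hre, ← tsum_mul_left]
  refine tsum_congr fun n => ?_
  rcases Nat.eq_zero_or_pos n with hn | hn
  · subst hn
    simp [Complex.zero_cpow hs0]
  · exact zeta_term_eq t₀ h x hn s

/-- **«interchange the sum and integral and move the line of integration back to 1/2»:** the `j`-th
term integrates, over `Re s = σ ≥ 1/2`, to `(1/√j)(j√π)^{−it₀} G(x + log(j√π)/(2π))`
(`integral_fourier_kernel_shift`, `fourier_kernel_eq` with `k = 0`). [cite: Platt2017, Lemma 3.2 p. 2453 (proof)] -/
theorem integral_zeta_term {σ : ℝ} (t₀ : ℝ) {h : ℝ} (x : ℝ) (n : ℕ) (hσ : 1 / 2 ≤ σ) (hh : 0 < h) :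
    ∫ y : ℝ, ((((1 / Real.sqrt (n : ℝ) : ℝ) : ℂ) * (((n : ℝ) * Real.sqrt π : ℝ) : ℂ) ^ (-(I * t₀))) *
      (fun s : ℂ => Complex.Gamma (s / 2) * Complex.exp (π * (-I * (s - 1 / 2)) / 4) *
        Complex.exp (-(-I * (s - 1 / 2) - t₀) ^ 2 / (2 * h ^ 2)) * (-2 * π * I * (-I * (s - 1 / 2) - t₀)) ^ (0:ℕ) *
        Complex.exp (-2 * π * I * (-I * (s - 1 / 2) - t₀) * ((x + Real.log ((n : ℝ) * Real.sqrt π) / (2 * π)) : ℝ))) ((σ : ℂ) + ((y : ℝ) : ℂ) * I)) = (((1 / Real.sqrt (n : ℝ) : ℝ) : ℂ) * (((n : ℝ) * Real.sqrt π : ℝ) : ℂ) ^ (-(I * t₀))) * (∫ t : ℝ, Complex.Gamma ((1 / 2 + (t + t₀) * I) / 2) *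
          Complex.exp ((π * (t + t₀) / 4 - t ^ 2 / (2 * h ^ 2) : ℝ) : ℂ) *
          Complex.exp (-(2 * π * t * (x + Real.log ((n : ℝ) * Real.sqrt π) / (2 * π)) : ℝ) * I)) := by
  rw [integral_const_mul]
  congr 1
  rw [← integral_fourier_kernel_shift 0 (σ := σ) t₀ (x + Real.log ((n : ℝ) * Real.sqrt π) / (2 * π)) hσ hh]
  rw [← integral_add_right_eq_self (μ := volume) (fun y : ℝ => (fun s : ℂ => Complex.Gamma (s / 2) * Complex.exp (π * (-I * (s - 1 / 2)) / 4) *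
        Complex.exp (-(-I * (s - 1 / 2) - t₀) ^ 2 / (2 * h ^ 2)) * (-2 * π * I * (-I * (s - 1 / 2) - t₀)) ^ (0:ℕ) *
        Complex.exp (-2 * π * I * (-I * (s - 1 / 2) - t₀) * ((x + Real.log ((n : ℝ) * Real.sqrt π) / (2 * π)) : ℝ))) (((1 / 2 : ℝ) : ℂ) + ((y : ℝ) : ℂ) * I)) t₀]
  refine integral_congr_ae (ae_of_all _ fun t => ?_)
  have := fourier_kernel_eq 0 t₀ h (x + Real.log ((n : ℝ) * Real.sqrt π) / (2 * π)) t
  simp only [pow_zero, mul_one] at this ⊢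
  exact this.symm

/-- **Norm-summability of the `j`-th terms on `Re s = σ`** (what justifies «interchange the sum and
integral»): `∫ |T_j(σ+iy)| dy ≤ e^{(2σ−1)²/(8h²)} C(σ,t₀,h,0) j^{−σ}` for `σ ≥ 1/2`, `x ≥ 0`
(`|(j√π)^{−it₀}| = 1`, display (A.1)'s modulus on the far line, `e^{−πu(2σ−1)} ≤ (j√π)^{−(2σ−1)/2}`).
[cite: Platt2017, Lemma 3.2 p. 2453 (proof)] -/
theorem integral_norm_zeta_term_le {σ t₀ h x : ℝ} (hσ : 1 / 2 ≤ σ) (hh : 0 < h) (hx : 0 ≤ x) (n : ℕ) :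
    ∫ y : ℝ, ‖((((1 / Real.sqrt (n : ℝ) : ℝ) : ℂ) * (((n : ℝ) * Real.sqrt π : ℝ) : ℂ) ^ (-(I * t₀))) *
      (fun s : ℂ => Complex.Gamma (s / 2) * Complex.exp (π * (-I * (s - 1 / 2)) / 4) *
        Complex.exp (-(-I * (s - 1 / 2) - t₀) ^ 2 / (2 * h ^ 2)) * (-2 * π * I * (-I * (s - 1 / 2) - t₀)) ^ (0:ℕ) *
        Complex.exp (-2 * π * I * (-I * (s - 1 / 2) - t₀) * ((x + Real.log ((n : ℝ) * Real.sqrt π) / (2 * π)) : ℝ))) ((σ : ℂ) + ((y : ℝ) : ℂ) * I))‖ ≤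
      Real.exp ((2 * σ - 1) ^ 2 / (8 * h ^ 2)) *
        (∫ t : ℝ, ‖Complex.Gamma ((σ + (t + t₀) * I) / 2)‖ * Real.exp (π * (t + t₀) / 4 - t ^ 2 / (2 * h ^ 2))) *
        (n : ℝ) ^ (-σ) := by
  set C₀ : ℝ := ∫ t : ℝ, ‖Complex.Gamma ((σ + (t + t₀) * I) / 2)‖ *
    Real.exp (π * (t + t₀) / 4 - t ^ 2 / (2 * h ^ 2)) with hC₀
  have hC₀0 : 0 ≤ C₀ := integral_nonneg fun t => by positivity
  set u : ℝ := (x + Real.log ((n : ℝ) * Real.sqrt π) / (2 * π)) with hu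
  -- the integral of `|Ψ₀(σ+iy; u)|`
  have hnormline : ∫ y : ℝ, ‖(fun s : ℂ => Complex.Gamma (s / 2) * Complex.exp (π * (-I * (s - 1 / 2)) / 4) *
        Complex.exp (-(-I * (s - 1 / 2) - t₀) ^ 2 / (2 * h ^ 2)) * (-2 * π * I * (-I * (s - 1 / 2) - t₀)) ^ (0:ℕ) *
        Complex.exp (-2 * π * I * (-I * (s - 1 / 2) - t₀) * ((x + Real.log ((n : ℝ) * Real.sqrt π) / (2 * π)) : ℝ))) ((σ : ℂ) + ((y : ℝ) : ℂ) * I)‖ =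
      Real.exp ((2 * σ - 1) ^ 2 / (8 * h ^ 2) - π * u * (2 * σ - 1)) * C₀ := by
    rw [← integral_add_right_eq_self (μ := volume)
      (fun y : ℝ => ‖(fun s : ℂ => Complex.Gamma (s / 2) * Complex.exp (π * (-I * (s - 1 / 2)) / 4) *
        Complex.exp (-(-I * (s - 1 / 2) - t₀) ^ 2 / (2 * h ^ 2)) * (-2 * π * I * (-I * (s - 1 / 2) - t₀)) ^ (0:ℕ) *
        Complex.exp (-2 * π * I * (-I * (s - 1 / 2) - t₀) * ((x + Real.log ((n : ℝ) * Real.sqrt π) / (2 * π)) : ℝ))) ((σ : ℂ) + ((y : ℝ) : ℂ) * I)‖) t₀]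
    simp only []
    have hpt : ∀ t : ℝ, ‖(fun s : ℂ => Complex.Gamma (s / 2) * Complex.exp (π * (-I * (s - 1 / 2)) / 4) *
        Complex.exp (-(-I * (s - 1 / 2) - t₀) ^ 2 / (2 * h ^ 2)) * (-2 * π * I * (-I * (s - 1 / 2) - t₀)) ^ (0:ℕ) *
        Complex.exp (-2 * π * I * (-I * (s - 1 / 2) - t₀) * ((x + Real.log ((n : ℝ) * Real.sqrt π) / (2 * π)) : ℝ))) ((σ : ℂ) + ((t + t₀ : ℝ) : ℂ) * I)‖ =
        Real.exp ((2 * σ - 1) ^ 2 / (8 * h ^ 2) - π * u * (2 * σ - 1)) *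
          (‖Complex.Gamma ((σ + (t + t₀) * I) / 2)‖ * Real.exp (π * (t + t₀) / 4 - t ^ 2 / (2 * h ^ 2))) := by
      intro t
      have h0 := norm_fourier_kernel_far 0 σ t₀ h u t
      simp only [pow_zero, mul_one] at h0 ⊢
      rw [hu] at h0 ⊢
      exact h0
    simp only [] at hpt
    rw [show (fun t : ℝ => _) = fun t : ℝ => Real.exp ((2 * σ - 1) ^ 2 / (8 * h ^ 2) - π * u * (2 * σ - 1)) *
        (‖Complex.Gamma ((σ + (t + t₀) * I) / 2)‖ * Real.exp (π * (t + t₀) / 4 - t ^ 2 / (2 * h ^ 2)))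
      from funext hpt, integral_const_mul]
  -- the norm of the `j`-th term integrand
  have hT : (fun y : ℝ => ‖((((1 / Real.sqrt (n : ℝ) : ℝ) : ℂ) * (((n : ℝ) * Real.sqrt π : ℝ) : ℂ) ^ (-(I * t₀))) *
      (fun s : ℂ => Complex.Gamma (s / 2) * Complex.exp (π * (-I * (s - 1 / 2)) / 4) *
        Complex.exp (-(-I * (s - 1 / 2) - t₀) ^ 2 / (2 * h ^ 2)) * (-2 * π * I * (-I * (s - 1 / 2) - t₀)) ^ (0:ℕ) *
        Complex.exp (-2 * π * I * (-I * (s - 1 / 2) - t₀) * ((x + Real.log ((n : ℝ) * Real.sqrt π) / (2 * π)) : ℝ))) ((σ : ℂ) + ((y : ℝ) : ℂ) * I))‖) = fun y : ℝ =>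
      ‖(((1 / Real.sqrt (n : ℝ) : ℝ) : ℂ) * (((n : ℝ) * Real.sqrt π : ℝ) : ℂ) ^ (-(I * t₀)))‖ * ‖(fun s : ℂ => Complex.Gamma (s / 2) * Complex.exp (π * (-I * (s - 1 / 2)) / 4) *
        Complex.exp (-(-I * (s - 1 / 2) - t₀) ^ 2 / (2 * h ^ 2)) * (-2 * π * I * (-I * (s - 1 / 2) - t₀)) ^ (0:ℕ) *
        Complex.exp (-2 * π * I * (-I * (s - 1 / 2) - t₀) * ((x + Real.log ((n : ℝ) * Real.sqrt π) / (2 * π)) : ℝ))) ((σ : ℂ) + ((y : ℝ) : ℂ) * I)‖ := funext fun y => norm_mul _ _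
  rw [hT, integral_const_mul, hnormline]
  rcases Nat.eq_zero_or_pos n with hn | hn
  · subst hn
    have hσ0 : -σ ≠ 0 := by linarith
    simp [Real.zero_rpow hσ0]
  have hn0 : (0 : ℝ) < n := by exact_mod_cast hn
  have hsqπ : 0 < Real.sqrt π := Real.sqrt_pos.mpr Real.pi_pos
  have hnπ0 : 0 < (n : ℝ) * Real.sqrt π := by positivity
  have hcoef : ‖(((1 / Real.sqrt (n : ℝ) : ℝ) : ℂ) * (((n : ℝ) * Real.sqrt π : ℝ) : ℂ) ^ (-(I * t₀)))‖ = (n : ℝ) ^ (-(1 / 2 : ℝ)) := by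
    rw [norm_mul, Complex.norm_cpow_eq_rpow_re_of_pos hnπ0, Complex.norm_real, Real.norm_eq_abs,
      abs_of_pos (by positivity), Real.sqrt_eq_rpow, Real.rpow_neg hn0.le, one_div]
    simp
  rw [hcoef]
  -- `e^{-π u (2σ-1)} ≤ n^{1/2-σ}`
  have hdec : Real.exp ((2 * σ - 1) ^ 2 / (8 * h ^ 2) - π * u * (2 * σ - 1)) ≤
      Real.exp ((2 * σ - 1) ^ 2 / (8 * h ^ 2)) * (n : ℝ) ^ (1 / 2 - σ) := by
    set L : ℝ := Real.log ((n : ℝ) * Real.sqrt π) with hL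
    have e1 : Real.exp ((2 * σ - 1) ^ 2 / (8 * h ^ 2) - π * u * (2 * σ - 1)) =
        Real.exp ((2 * σ - 1) ^ 2 / (8 * h ^ 2)) * (Real.exp (-(π * x * (2 * σ - 1))) *
          Real.exp (L * (-(2 * σ - 1) / 2))) := by
      rw [← Real.exp_add, ← Real.exp_add]; congr 1; rw [hu]; field_simp; ring
    have e2 : Real.exp (L * (-(2 * σ - 1) / 2)) = (n : ℝ) ^ (1 / 2 - σ) * π ^ ((1 - 2 * σ) / 4) := by
      rw [hL, ← Real.rpow_def_of_pos hnπ0, Real.mul_rpow hn0.le hsqπ.le, Real.sqrt_eq_rpow,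
        ← Real.rpow_mul Real.pi_pos.le]
      congr 1 <;> [congr 1; congr 1] <;> ring
    rw [e1, e2]
    have hx1 : Real.exp (-(π * x * (2 * σ - 1))) ≤ 1 := by
      rw [Real.exp_le_one_iff, neg_nonpos]
      have : 0 ≤ 2 * σ - 1 := by linarith
      have := Real.pi_pos
      positivity
    have hπ1 : π ^ ((1 - 2 * σ) / 4) ≤ 1 :=
      Real.rpow_le_one_of_one_le_of_nonpos (by linarith [Real.pi_gt_three]) (by linarith)
    have h0 : 0 ≤ (n : ℝ) ^ (1 / 2 - σ) := by positivity
    calc Real.exp ((2 * σ - 1) ^ 2 / (8 * h ^ 2)) * (Real.exp (-(π * x * (2 * σ - 1))) *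
          ((n : ℝ) ^ (1 / 2 - σ) * π ^ ((1 - 2 * σ) / 4)))
        ≤ Real.exp ((2 * σ - 1) ^ 2 / (8 * h ^ 2)) * (1 * ((n : ℝ) ^ (1 / 2 - σ) * 1)) := by gcongr
      _ = _ := by ring
  have hpow : (n : ℝ) ^ (-(1 / 2 : ℝ)) * (n : ℝ) ^ (1 / 2 - σ) = (n : ℝ) ^ (-σ) := by
    rw [← Real.rpow_add hn0]; congr 1; ring
  calc (n : ℝ) ^ (-(1 / 2 : ℝ)) * (Real.exp ((2 * σ - 1) ^ 2 / (8 * h ^ 2) - π * u * (2 * σ - 1)) * C₀)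
      ≤ (n : ℝ) ^ (-(1 / 2 : ℝ)) * (Real.exp ((2 * σ - 1) ^ 2 / (8 * h ^ 2)) * (n : ℝ) ^ (1 / 2 - σ) * C₀) := by
        gcongr
    _ = Real.exp ((2 * σ - 1) ^ 2 / (8 * h ^ 2)) * C₀ * ((n : ℝ) ^ (-(1 / 2 : ℝ)) * (n : ℝ) ^ (1 / 2 - σ)) := by
        ring
    _ = _ := by rw [hpow]

end Platt2017

open Platt2017 in
/-- **Platt 2017, Lemma 3.2 (p. 2453), PROVED for `x ≥ 0`:** «Let `F` be the Fourier transform of `f`.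
Then `|F(x) − Σ_{j=1}^∞ (1/√j) (j√π)^{−it₀} G(x + log(j√π)/(2π))| = 2π^{5/4} exp(1/(8h²) − t₀²/(2h²) − πx)`.
*Proof.* We start with `F(x) = ∫ f(t) e(−tx) dt` and substitute `s = 1/2 + i(t+t₀)`. We then shift the
line of integration right to `ℜ(s) = σ > 1` picking up the simple pole of `ζ(s)` with residue `1` at
`s = 1`. Now write `ζ(s)` as a sum (over `j`), interchange the sum and integral and move the line of
integration back to `1/2`.» («The meat of step (5)», p. 2453.) Here `f(t) = Λ(t+t₀) e^{π(t+t₀)/4 −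
t²/(2h²)}`, `Λ(t) = π^{−it/2} Γ((1/2+it)/2) ζ(1/2+it)`, `G(u) = ∫ g(t;0) e(−tu) dt`,
`g(t;0) = Γ((1/2+i(t+t₀))/2) e^{π(t+t₀)/4 − t²/(2h²)}`, `e(x) = e^{2πix}`, all written out; the series
is summed over `j ∈ ℕ` (the `j = 0` term is `0`: `1/√0 = 0`), and ITS CONVERGENCE IS PART OF THE
CONCLUSION; the identity holds for every `h > 0`, `t₀ ∈ ℝ` and `x ≥ 0` (the proof is the printed one
with `σ = 3`: `Platt2017.fourierF_line_shift` for the shift across the pole,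
`fourierF_kernel_eq_tsum`/`zeta_term_eq` for «write ζ(s) as a sum» — the `j`-th term is
`(1/√j)(j√π)^{−it₀} Ψ₀(s; x + log(j√π)/(2π))` —, Mathlib's `integral_tsum_of_summable_integral_norm`
with `integral_norm_zeta_term_le` for the interchange, and `integral_zeta_term` (the pole-free shift
`integral_fourier_kernel_shift` back to `Re s = 1/2`) term by term; the right-hand side is
`norm_fourierF_residue`). NOT typed: `x < 0` (reduced in print via `F(−x) = conj F(x)`).
[cite: Platt2017, Lemma 3.2 p. 2453 (statement and proof)] -/
theorem platt2017_lemma32 {t₀ h x : ℝ} (hh : 0 < h) (hx : 0 ≤ x) :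
    Summable (fun n : ℕ => (((1 / Real.sqrt (n : ℝ) : ℝ) : ℂ) * (((n : ℝ) * Real.sqrt π : ℝ) : ℂ) ^ (-(I * t₀))) * (∫ t : ℝ, Complex.Gamma ((1 / 2 + (t + t₀) * I) / 2) *
          Complex.exp ((π * (t + t₀) / 4 - t ^ 2 / (2 * h ^ 2) : ℝ) : ℂ) *
          Complex.exp (-(2 * π * t * (x + Real.log ((n : ℝ) * Real.sqrt π) / (2 * π)) : ℝ) * I))) ∧
    ‖(∫ t : ℝ, (π : ℂ) ^ (-(I * (t + t₀ : ℝ) / 2)) * Complex.Gamma ((1 / 2 + (t + t₀ : ℝ) * I) / 2) *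
        riemannZeta (1 / 2 + (t + t₀ : ℝ) * I) *
        Complex.exp ((π * (t + t₀) / 4 - t ^ 2 / (2 * h ^ 2) : ℝ) : ℂ) *
        Complex.exp (-(2 * π * t * x : ℝ) * I)) - ∑' n : ℕ, (((1 / Real.sqrt (n : ℝ) : ℝ) : ℂ) * (((n : ℝ) * Real.sqrt π : ℝ) : ℂ) ^ (-(I * t₀))) * (∫ t : ℝ, Complex.Gamma ((1 / 2 + (t + t₀) * I) / 2) *
          Complex.exp ((π * (t + t₀) / 4 - t ^ 2 / (2 * h ^ 2) : ℝ) : ℂ) *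
          Complex.exp (-(2 * π * t * (x + Real.log ((n : ℝ) * Real.sqrt π) / (2 * π)) : ℝ) * I))‖ =
      2 * π ^ (5 / 4 : ℝ) * Real.exp (1 / (8 * h ^ 2) - t₀ ^ 2 / (2 * h ^ 2) - π * x) := by
  -- `F(x) = ∫ Ξ(1/2 + iy) dy = ∫ Ξ(3 + iy) dy − 2π r₁`
  have hker : (fun t : ℝ => (π : ℂ) ^ (-(I * (t + t₀ : ℝ) / 2)) *
      Complex.Gamma ((1 / 2 + (t + t₀ : ℝ) * I) / 2) * riemannZeta (1 / 2 + (t + t₀ : ℝ) * I) *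
      Complex.exp ((π * (t + t₀) / 4 - t ^ 2 / (2 * h ^ 2) : ℝ) : ℂ) *
      Complex.exp (-(2 * π * t * x : ℝ) * I)) =
      fun t : ℝ => (fun s : ℂ => ((π ^ (1 / 4 : ℝ) : ℝ) : ℂ) * completedRiemannZeta s * Complex.exp (π * (-I * (s - 1 / 2)) / 4) *
        Complex.exp (-(-I * (s - 1 / 2) - t₀) ^ 2 / (2 * h ^ 2)) *
        Complex.exp (-2 * π * I * (-I * (s - 1 / 2) - t₀) * x)) (((1 / 2 : ℝ) : ℂ) + ((t + t₀ : ℝ) : ℂ) * I) :=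
    funext fun t => fourierF_kernel_eq t₀ h x t
  have htr : ∫ t : ℝ, (fun s : ℂ => ((π ^ (1 / 4 : ℝ) : ℝ) : ℂ) * completedRiemannZeta s * Complex.exp (π * (-I * (s - 1 / 2)) / 4) *
        Complex.exp (-(-I * (s - 1 / 2) - t₀) ^ 2 / (2 * h ^ 2)) *
        Complex.exp (-2 * π * I * (-I * (s - 1 / 2) - t₀) * x)) (((1 / 2 : ℝ) : ℂ) + ((t + t₀ : ℝ) : ℂ) * I) =
      ∫ y : ℝ, (fun s : ℂ => ((π ^ (1 / 4 : ℝ) : ℝ) : ℂ) * completedRiemannZeta s * Complex.exp (π * (-I * (s - 1 / 2)) / 4) *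
        Complex.exp (-(-I * (s - 1 / 2) - t₀) ^ 2 / (2 * h ^ 2)) *
        Complex.exp (-2 * π * I * (-I * (s - 1 / 2) - t₀) * x)) (((1 / 2 : ℝ) : ℂ) + ((y : ℝ) : ℂ) * I) :=
    integral_add_right_eq_self (μ := volume) (fun y : ℝ => (fun s : ℂ => ((π ^ (1 / 4 : ℝ) : ℝ) : ℂ) * completedRiemannZeta s * Complex.exp (π * (-I * (s - 1 / 2)) / 4) *
        Complex.exp (-(-I * (s - 1 / 2) - t₀) ^ 2 / (2 * h ^ 2)) *
        Complex.exp (-2 * π * I * (-I * (s - 1 / 2) - t₀) * x)) (((1 / 2 : ℝ) : ℂ) + ((y : ℝ) : ℂ) * I)) t₀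
  have hshift := fourierF_line_shift (σ := 3) (t₀ := t₀) (h := h) (x := x) (by norm_num) hh hx
  -- on `Re s = 3`: `Ξ = Σ_j T_j`
  have hexp : ∫ y : ℝ, (fun s : ℂ => ((π ^ (1 / 4 : ℝ) : ℝ) : ℂ) * completedRiemannZeta s * Complex.exp (π * (-I * (s - 1 / 2)) / 4) *
        Complex.exp (-(-I * (s - 1 / 2) - t₀) ^ 2 / (2 * h ^ 2)) *
        Complex.exp (-2 * π * I * (-I * (s - 1 / 2) - t₀) * x)) (((3 : ℝ) : ℂ) + ((y : ℝ) : ℂ) * I) = ∫ y : ℝ, ∑' n : ℕ, ((((1 / Real.sqrt (n : ℝ) : ℝ) : ℂ) * (((n : ℝ) * Real.sqrt π : ℝ) : ℂ) ^ (-(I * t₀))) *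
      (fun s : ℂ => Complex.Gamma (s / 2) * Complex.exp (π * (-I * (s - 1 / 2)) / 4) *
        Complex.exp (-(-I * (s - 1 / 2) - t₀) ^ 2 / (2 * h ^ 2)) * (-2 * π * I * (-I * (s - 1 / 2) - t₀)) ^ (0:ℕ) *
        Complex.exp (-2 * π * I * (-I * (s - 1 / 2) - t₀) * ((x + Real.log ((n : ℝ) * Real.sqrt π) / (2 * π)) : ℝ))) (((3 : ℝ) : ℂ) + ((y : ℝ) : ℂ) * I)) := by
    refine integral_congr_ae (ae_of_all _ fun y => ?_)
    exact fourierF_kernel_eq_tsum t₀ h x (s := ((3 : ℝ) : ℂ) + ((y : ℝ) : ℂ) * I) (by simp)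
  have hint : ∀ n : ℕ, Integrable fun y : ℝ => ((((1 / Real.sqrt (n : ℝ) : ℝ) : ℂ) * (((n : ℝ) * Real.sqrt π : ℝ) : ℂ) ^ (-(I * t₀))) *
      (fun s : ℂ => Complex.Gamma (s / 2) * Complex.exp (π * (-I * (s - 1 / 2)) / 4) *
        Complex.exp (-(-I * (s - 1 / 2) - t₀) ^ 2 / (2 * h ^ 2)) * (-2 * π * I * (-I * (s - 1 / 2) - t₀)) ^ (0:ℕ) *
        Complex.exp (-2 * π * I * (-I * (s - 1 / 2) - t₀) * ((x + Real.log ((n : ℝ) * Real.sqrt π) / (2 * π)) : ℝ))) (((3 : ℝ) : ℂ) + ((y : ℝ) : ℂ) * I)) := fun n =>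
    (integrable_fourier_kernel_vertical' 0 (σ := 3) (t₀ := t₀) (x + Real.log ((n : ℝ) * Real.sqrt π) / (2 * π)) hh (by norm_num) le_rfl).const_mul _
  have hsumM : Summable fun n : ℕ => Real.exp ((2 * 3 - 1) ^ 2 / (8 * h ^ 2)) *
      (∫ t : ℝ, ‖Complex.Gamma ((3 + (t + t₀) * I) / 2)‖ * Real.exp (π * (t + t₀) / 4 - t ^ 2 / (2 * h ^ 2))) *
      (n : ℝ) ^ (-(3 : ℝ)) :=
    (Real.summable_nat_rpow.2 (by norm_num)).mul_left _
  have hsum : Summable fun n : ℕ => ∫ y : ℝ, ‖((((1 / Real.sqrt (n : ℝ) : ℝ) : ℂ) * (((n : ℝ) * Real.sqrt π : ℝ) : ℂ) ^ (-(I * t₀))) *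
      (fun s : ℂ => Complex.Gamma (s / 2) * Complex.exp (π * (-I * (s - 1 / 2)) / 4) *
        Complex.exp (-(-I * (s - 1 / 2) - t₀) ^ 2 / (2 * h ^ 2)) * (-2 * π * I * (-I * (s - 1 / 2) - t₀)) ^ (0:ℕ) *
        Complex.exp (-2 * π * I * (-I * (s - 1 / 2) - t₀) * ((x + Real.log ((n : ℝ) * Real.sqrt π) / (2 * π)) : ℝ))) (((3 : ℝ) : ℂ) + ((y : ℝ) : ℂ) * I))‖ := by
    refine Summable.of_nonneg_of_le (fun n => integral_nonneg fun y => norm_nonneg _) (fun n => ?_) hsumM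
    have := integral_norm_zeta_term_le (σ := 3) (t₀ := t₀) (h := h) (x := x) (by norm_num) hh hx n
    push_cast at this ⊢
    exact this
  have hswap := integral_tsum_of_summable_integral_norm hint hsum
  have hterm : ∀ n : ℕ, ∫ y : ℝ, ((((1 / Real.sqrt (n : ℝ) : ℝ) : ℂ) * (((n : ℝ) * Real.sqrt π : ℝ) : ℂ) ^ (-(I * t₀))) *
      (fun s : ℂ => Complex.Gamma (s / 2) * Complex.exp (π * (-I * (s - 1 / 2)) / 4) *
        Complex.exp (-(-I * (s - 1 / 2) - t₀) ^ 2 / (2 * h ^ 2)) * (-2 * π * I * (-I * (s - 1 / 2) - t₀)) ^ (0:ℕ) *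
        Complex.exp (-2 * π * I * (-I * (s - 1 / 2) - t₀) * ((x + Real.log ((n : ℝ) * Real.sqrt π) / (2 * π)) : ℝ))) (((3 : ℝ) : ℂ) + ((y : ℝ) : ℂ) * I)) = (((1 / Real.sqrt (n : ℝ) : ℝ) : ℂ) * (((n : ℝ) * Real.sqrt π : ℝ) : ℂ) ^ (-(I * t₀))) * (∫ t : ℝ, Complex.Gamma ((1 / 2 + (t + t₀) * I) / 2) *
          Complex.exp ((π * (t + t₀) / 4 - t ^ 2 / (2 * h ^ 2) : ℝ) : ℂ) *
          Complex.exp (-(2 * π * t * (x + Real.log ((n : ℝ) * Real.sqrt π) / (2 * π)) : ℝ) * I)) := fun n =>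
    integral_zeta_term (σ := 3) t₀ (h := h) x n (by norm_num) hh
  have hS : Summable fun n : ℕ => (((1 / Real.sqrt (n : ℝ) : ℝ) : ℂ) * (((n : ℝ) * Real.sqrt π : ℝ) : ℂ) ^ (-(I * t₀))) * (∫ t : ℝ, Complex.Gamma ((1 / 2 + (t + t₀) * I) / 2) *
          Complex.exp ((π * (t + t₀) / 4 - t ^ 2 / (2 * h ^ 2) : ℝ) : ℂ) *
          Complex.exp (-(2 * π * t * (x + Real.log ((n : ℝ) * Real.sqrt π) / (2 * π)) : ℝ) * I)) := by
    have h1 : Summable fun n : ℕ => ∫ y : ℝ, ((((1 / Real.sqrt (n : ℝ) : ℝ) : ℂ) * (((n : ℝ) * Real.sqrt π : ℝ) : ℂ) ^ (-(I * t₀))) *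
      (fun s : ℂ => Complex.Gamma (s / 2) * Complex.exp (π * (-I * (s - 1 / 2)) / 4) *
        Complex.exp (-(-I * (s - 1 / 2) - t₀) ^ 2 / (2 * h ^ 2)) * (-2 * π * I * (-I * (s - 1 / 2) - t₀)) ^ (0:ℕ) *
        Complex.exp (-2 * π * I * (-I * (s - 1 / 2) - t₀) * ((x + Real.log ((n : ℝ) * Real.sqrt π) / (2 * π)) : ℝ))) (((3 : ℝ) : ℂ) + ((y : ℝ) : ℂ) * I)) :=
      Summable.of_norm_bounded hsum fun n => norm_integral_le_integral_norm _
    exact h1.congr hterm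
  refine ⟨hS, ?_⟩
  have hseries : ∑' n : ℕ, (((1 / Real.sqrt (n : ℝ) : ℝ) : ℂ) * (((n : ℝ) * Real.sqrt π : ℝ) : ℂ) ^ (-(I * t₀))) * (∫ t : ℝ, Complex.Gamma ((1 / 2 + (t + t₀) * I) / 2) *
          Complex.exp ((π * (t + t₀) / 4 - t ^ 2 / (2 * h ^ 2) : ℝ) : ℂ) *
          Complex.exp (-(2 * π * t * (x + Real.log ((n : ℝ) * Real.sqrt π) / (2 * π)) : ℝ) * I)) = ∫ y : ℝ, (fun s : ℂ => ((π ^ (1 / 4 : ℝ) : ℝ) : ℂ) * completedRiemannZeta s * Complex.exp (π * (-I * (s - 1 / 2)) / 4) *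
        Complex.exp (-(-I * (s - 1 / 2) - t₀) ^ 2 / (2 * h ^ 2)) *
        Complex.exp (-2 * π * I * (-I * (s - 1 / 2) - t₀) * x)) (((3 : ℝ) : ℂ) + ((y : ℝ) : ℂ) * I) := by
    rw [hexp, ← hswap]
    exact tsum_congr fun n => (hterm n).symm
  rw [hker, htr, hshift, hseries]
  rw [show ∀ (A B : ℂ), A - B - A = -B from fun A B => by ring, norm_neg, norm_mul, norm_mul,
    Complex.norm_two, Complex.norm_real, Real.norm_eq_abs, abs_of_pos Real.pi_pos,
    norm_fourierF_residue t₀ h x]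
  congr 1
  ring


/-! ### The reality of `Λ(t)`: `F(−x) = conj F(x)`, and the unconditional forms of Lemmas A.8, A.9, C.1 -/

namespace Platt2017

/-- Platt's `Λ(u) = π^{−iu/2} Γ((1/2+iu)/2) ζ(1/2+iu)` is `π^{1/4}` times Mathlib's completed zeta
function at `1/2 + iu`. [cite: Platt2017, §3 p. 2450 (definition of Λ)] -/
theorem Lambda_eq_completedZeta (u : ℝ) :
    (π : ℂ) ^ (-(I * u / 2)) * Complex.Gamma ((1 / 2 + u * I) / 2) * riemannZeta (1 / 2 + u * I) =
      ((π ^ (1 / 4 : ℝ) : ℝ) : ℂ) * completedRiemannZeta (1 / 2 + u * I) := by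
  set s₀ : ℂ := 1 / 2 + u * I with hs₀
  have hre : s₀.re = 1 / 2 := by rw [hs₀]; simp
  have hs0 : s₀ ≠ 0 := fun h0 => by
    have := congrArg Complex.re h0; rw [hre] at this; simp at this
  have hπ0 : (π : ℂ) ≠ 0 := by exact_mod_cast Real.pi_pos.ne'
  have hΛ : completedRiemannZeta s₀ = (π : ℂ) ^ (-s₀ / 2) * Complex.Gamma (s₀ / 2) * riemannZeta s₀ := by
    rw [riemannZeta_def_of_ne_zero hs0, ← Complex.Gammaℝ_def,
      mul_div_cancel₀ _ (Complex.Gammaℝ_ne_zero_of_re_pos (by rw [hre]; norm_num))]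
  have hπpow : (π : ℂ) ^ (-(I * u / 2)) = ((π ^ (1 / 4 : ℝ) : ℝ) : ℂ) * (π : ℂ) ^ (-s₀ / 2) := by
    rw [Complex.ofReal_cpow Real.pi_pos.le, ← Complex.cpow_add _ _ hπ0]
    congr 1
    rw [hs₀]; push_cast; ring
  rw [hΛ, hπpow]
  ring

/-- **`Λ(u)` is real** («`Λ(t) = π^{−it/2} Γ((1/2+it)/2) ζ(1/2+it)` which, by the functional equation for
`ζ`, is real-valued», p. 2451): `conj Λ(u) = Λ(u)` — from `Λ(1−s) = Λ(s)` (Mathlib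
`completedRiemannZeta_one_sub`) and `conj Λ(s) = Λ(conj s)`. [cite: Platt2017, §3 pp. 2450–2451] -/
theorem conj_Lambda (u : ℝ) :
    conj ((π : ℂ) ^ (-(I * u / 2)) * Complex.Gamma ((1 / 2 + u * I) / 2) * riemannZeta (1 / 2 + u * I)) =
      (π : ℂ) ^ (-(I * u / 2)) * Complex.Gamma ((1 / 2 + u * I) / 2) * riemannZeta (1 / 2 + u * I) := by
  rw [Lambda_eq_completedZeta, map_mul, Complex.conj_ofReal]
  congr 1
  set s₀ : ℂ := 1 / 2 + u * I with hs₀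
  have hre : s₀.re = 1 / 2 := by rw [hs₀]; simp
  have hs0 : s₀ ≠ 0 := fun h0 => by
    have := congrArg Complex.re h0; rw [hre] at this; simp at this
  have hconj : conj s₀ = 1 - s₀ := by
    apply Complex.ext <;> simp [hs₀]; norm_num
  -- `conj Λ(s₀) = Γ_ℝ(conj s₀) ζ(conj s₀) = Λ(conj s₀) = Λ(1 - s₀) = Λ(s₀)`
  have hs0' : conj s₀ ≠ 0 := by rw [hconj]; intro h; have := congrArg Complex.re h; rw [Complex.sub_re, hre] at this; simp at this; norm_num at this
  have h1 : conj (completedRiemannZeta s₀) = completedRiemannZeta (conj s₀) := by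
    have hG : completedRiemannZeta s₀ = Complex.Gammaℝ s₀ * riemannZeta s₀ := by
      rw [riemannZeta_def_of_ne_zero hs0, mul_div_cancel₀ _ (Complex.Gammaℝ_ne_zero_of_re_pos (by rw [hre]; norm_num))]
    have hG' : completedRiemannZeta (conj s₀) = Complex.Gammaℝ (conj s₀) * riemannZeta (conj s₀) := by
      rw [riemannZeta_def_of_ne_zero hs0', mul_div_cancel₀ _ (Complex.Gammaℝ_ne_zero_of_re_pos (by simp [hre]))]
    rw [hG, hG', map_mul, riemannZeta_conj]
    congr 1
    have h2 : conj (2 : ℂ) = 2 := map_ofNat _ 2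
    have hhalf : conj (s₀ / 2) = conj s₀ / 2 := by rw [map_div₀, h2]
    have hhalf' : conj (-s₀ / 2) = -conj s₀ / 2 := by rw [map_div₀, map_neg, h2]
    rw [Complex.Gammaℝ_def, Complex.Gammaℝ_def, map_mul, ← Complex.Gamma_conj, hhalf]
    congr 1
    have harg : ((π : ℝ) : ℂ).arg ≠ π := by
      rw [Complex.arg_ofReal_of_nonneg Real.pi_pos.le]; exact Real.pi_pos.ne
    have := Complex.cpow_conj (π : ℂ) (-s₀ / 2) harg
    rw [Complex.conj_ofReal, hhalf'] at this
    exact this.symm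
  rw [h1, hconj, completedRiemannZeta_one_sub]

end Platt2017


namespace Platt2017

/-- `f(t) e(−tx)` conjugates to `f(t) e(tx)` (`f` is real). [cite: Platt2017, Lemma A.8 p. 2461 (proof: «Since f(t) is real, F(−x) = conj F(x)»)] -/
theorem fourierF_integrand_conj (t₀ h x t : ℝ) :
    conj ((π : ℂ) ^ (-(I * (t + t₀ : ℝ) / 2)) * Complex.Gamma ((1 / 2 + (t + t₀ : ℝ) * I) / 2) *
        riemannZeta (1 / 2 + (t + t₀ : ℝ) * I) *
        Complex.exp ((π * (t + t₀) / 4 - t ^ 2 / (2 * h ^ 2) : ℝ) : ℂ) *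
        Complex.exp (-(2 * π * t * x : ℝ) * I)) = ((π : ℂ) ^ (-(I * (t + t₀ : ℝ) / 2)) * Complex.Gamma ((1 / 2 + (t + t₀ : ℝ) * I) / 2) *
        riemannZeta (1 / 2 + (t + t₀ : ℝ) * I) *
        Complex.exp ((π * (t + t₀) / 4 - t ^ 2 / (2 * h ^ 2) : ℝ) : ℂ) *
        Complex.exp (-(2 * π * t * (-x) : ℝ) * I)) := by
  have hΛ := conj_Lambda (t + t₀)
  rw [map_mul, map_mul, hΛ, ← Complex.exp_conj, ← Complex.exp_conj, Complex.conj_ofReal, map_mul,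
    map_neg, Complex.conj_ofReal, Complex.conj_I]
  congr 2
  push_cast
  ring

/-- **`F(−x) = conj F(x)`** («Since `f(t)` is real, its Fourier Transform `F(x)` has the property
`F(−x) = conj F(x)`»). [cite: Platt2017, Lemma A.8 p. 2461 (proof)] -/
theorem fourierF_neg (t₀ h x : ℝ) : (∫ t : ℝ, (π : ℂ) ^ (-(I * (t + t₀ : ℝ) / 2)) * Complex.Gamma ((1 / 2 + (t + t₀ : ℝ) * I) / 2) *
        riemannZeta (1 / 2 + (t + t₀ : ℝ) * I) *
        Complex.exp ((π * (t + t₀) / 4 - t ^ 2 / (2 * h ^ 2) : ℝ) : ℂ) *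
        Complex.exp (-(2 * π * t * (-x) : ℝ) * I)) = conj (∫ t : ℝ, (π : ℂ) ^ (-(I * (t + t₀ : ℝ) / 2)) * Complex.Gamma ((1 / 2 + (t + t₀ : ℝ) * I) / 2) *
        riemannZeta (1 / 2 + (t + t₀ : ℝ) * I) *
        Complex.exp ((π * (t + t₀) / 4 - t ^ 2 / (2 * h ^ 2) : ℝ) : ℂ) *
        Complex.exp (-(2 * π * t * x : ℝ) * I)) := by
  rw [← integral_conj]
  exact integral_congr_ae (ae_of_all _ fun t => (fourierF_integrand_conj t₀ h x t).symm)

end Platt2017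

open Platt2017 in
/-- **Platt 2017, Lemma A.8 (p. 2461), PROVED as printed (both signs of `x`):**
`|F(x)| ≤ ζ(σ)π^{(1−2σ)/4} C(σ,t₀,h,0) exp((2σ−1)²/(8h²) − π|x|(2σ−1)) + 2π^{5/4} exp(1/(8h²) − π|x| − t₀²/(2h²))`
for every real `x` (`σ = 2m+1 ≥ 3`, `h > 0`): the case `x ≥ 0` is `platt2017_lemmaA8`, and `x < 0` is
reduced to it by `F(−x) = conj F(x)` (`Platt2017.fourierF_neg`, from the reality of `Λ(t)`,
`Platt2017.conj_Lambda`: `Λ(1−s) = Λ(s)` and `conj Λ(s) = Λ(conj s)`), exactly as in print.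
[cite: Platt2017, Lemma A.8 p. 2461 (statement and proof)] -/
theorem platt2017_lemmaA8_abs {σ t₀ h : ℝ} {m : ℕ} (hσ : σ = 2 * m + 1) (hm : 1 ≤ m) (hh : 0 < h)
    (x : ℝ) :
    ‖(∫ t : ℝ, (π : ℂ) ^ (-(I * (t + t₀ : ℝ) / 2)) * Complex.Gamma ((1 / 2 + (t + t₀ : ℝ) * I) / 2) *
        riemannZeta (1 / 2 + (t + t₀ : ℝ) * I) *
        Complex.exp ((π * (t + t₀) / 4 - t ^ 2 / (2 * h ^ 2) : ℝ) : ℂ) *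
        Complex.exp (-(2 * π * t * x : ℝ) * I))‖ ≤
      (riemannZeta (σ : ℂ)).re * π ^ ((1 - 2 * σ) / 4) * (∫ t : ℝ, ‖Complex.Gamma ((σ + (t + t₀) * I) / 2)‖ *
            Real.exp (π * (t + t₀) / 4 - t ^ 2 / (2 * h ^ 2))) *
          Real.exp ((2 * σ - 1) ^ 2 / (8 * h ^ 2) - π * |x| * (2 * σ - 1)) +
        2 * π ^ (5 / 4 : ℝ) * Real.exp (1 / (8 * h ^ 2) - π * |x| - t₀ ^ 2 / (2 * h ^ 2)) := by
  rcases le_or_gt 0 x with hx | hx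
  · rw [abs_of_nonneg hx]; exact platt2017_lemmaA8 hσ hm hh hx
  · rw [abs_of_neg hx]
    have h := platt2017_lemmaA8 (t₀ := t₀) (x := -x) hσ hm hh (by linarith)
    rw [fourierF_neg, Complex.norm_conj] at h
    have e1 : π * (-x) * (2 * σ - 1) = π * -x * (2 * σ - 1) := by ring
    have e2 : π * (-x) = π * -x := by ring
    rw [e1, e2]
    exact h

open Platt2017 in
/-- **Platt 2017, Lemma A.9 (p. 2462), PROVED as printed** (its pointwise input Lemma A.8 now being a
theorem): «For `n ∈ [0, N/2]` we have `|F̃(n) − F(n/B)| = |Σ_{l∈ℤ≠0} F(n/B + lA)| ≤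
2ζ(σ)π^{(1−2σ)/4} C(σ,t₀,h,0) exp((2σ−1)²/(8h²) − Aπ(2σ−1)/2)(1 + 1/(Aπ(2σ−1)))
+ 4π^{5/4} exp((1−4t₀²)/(8h²) − Aπ/2)(1 + 1/(Aπ))`.» Here `F(u) = ∫ f(t) e(−tu) dt` is written out,
`x` real with `|x| ≤ A/2` in place of `n/B`, `σ = 2m+1 ≥ 3`, `h > 0`, `A > 0`,
`C(σ,t₀,h,0) = ∫|Γ((σ+i(t+t₀))/2)| e^{π(t+t₀)/4 − t²/(2h²)} dt`; `platt2017_lemmaA9_of_bound` fed with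
`platt2017_lemmaA8_abs`. [cite: Platt2017, Lemma A.9 p. 2462] -/
theorem platt2017_lemmaA9 {σ t₀ h A x : ℝ} {m : ℕ} (hσ : σ = 2 * m + 1) (hm : 1 ≤ m) (hh : 0 < h)
    (hA : 0 < A) (hx : |x| ≤ A / 2) :
    Summable (fun l : ℤ => (∫ t : ℝ, (π : ℂ) ^ (-(I * (t + t₀ : ℝ) / 2)) * Complex.Gamma ((1 / 2 + (t + t₀ : ℝ) * I) / 2) *
        riemannZeta (1 / 2 + (t + t₀ : ℝ) * I) *
        Complex.exp ((π * (t + t₀) / 4 - t ^ 2 / (2 * h ^ 2) : ℝ) : ℂ) *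
        Complex.exp (-(2 * π * t * (x + l * A) : ℝ) * I))) ∧
      ‖∑' l : ℤ, (∫ t : ℝ, (π : ℂ) ^ (-(I * (t + t₀ : ℝ) / 2)) * Complex.Gamma ((1 / 2 + (t + t₀ : ℝ) * I) / 2) *
        riemannZeta (1 / 2 + (t + t₀ : ℝ) * I) *
        Complex.exp ((π * (t + t₀) / 4 - t ^ 2 / (2 * h ^ 2) : ℝ) : ℂ) *
        Complex.exp (-(2 * π * t * (x + l * A) : ℝ) * I)) - (∫ t : ℝ, (π : ℂ) ^ (-(I * (t + t₀ : ℝ) / 2)) * Complex.Gamma ((1 / 2 + (t + t₀ : ℝ) * I) / 2) *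
        riemannZeta (1 / 2 + (t + t₀ : ℝ) * I) *
        Complex.exp ((π * (t + t₀) / 4 - t ^ 2 / (2 * h ^ 2) : ℝ) : ℂ) *
        Complex.exp (-(2 * π * t * x : ℝ) * I))‖ ≤
        2 * ((riemannZeta (σ : ℂ)).re * π ^ ((1 - 2 * σ) / 4) * (∫ t : ℝ, ‖Complex.Gamma ((σ + (t + t₀) * I) / 2)‖ *
            Real.exp (π * (t + t₀) / 4 - t ^ 2 / (2 * h ^ 2)))) *
            Real.exp ((2 * σ - 1) ^ 2 / (8 * h ^ 2) - A * π * (2 * σ - 1) / 2) *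
            (1 + 1 / (A * π * (2 * σ - 1))) +
          4 * π ^ (5 / 4 : ℝ) * Real.exp ((1 - 4 * t₀ ^ 2) / (8 * h ^ 2) - A * π / 2) *
            (1 + 1 / (A * π)) := by
  have hm1 : (1 : ℝ) ≤ m := by exact_mod_cast hm
  have hσ1 : 1 ≤ σ := by rw [hσ]; linarith
  have hζ0 : 0 ≤ (riemannZeta (σ : ℂ)).re := by
    have := norm_riemannZeta_le_re_riemannZeta (s := (σ : ℂ)) (by simp; rw [hσ]; linarith)
    simp only [Complex.ofReal_re] at this
    exact (norm_nonneg _).trans this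
  have hC0 : 0 ≤ (∫ t : ℝ, ‖Complex.Gamma ((σ + (t + t₀) * I) / 2)‖ *
            Real.exp (π * (t + t₀) / 4 - t ^ 2 / (2 * h ^ 2))) := integral_nonneg fun t => by positivity
  exact platt2017_lemmaA9_of_bound (F := fun u : ℝ => (∫ t : ℝ, (π : ℂ) ^ (-(I * (t + t₀ : ℝ) / 2)) * Complex.Gamma ((1 / 2 + (t + t₀ : ℝ) * I) / 2) *
        riemannZeta (1 / 2 + (t + t₀ : ℝ) * I) *
        Complex.exp ((π * (t + t₀) / 4 - t ^ 2 / (2 * h ^ 2) : ℝ) : ℂ) *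
        Complex.exp (-(2 * π * t * u : ℝ) * I))) hσ1 hA hx (by positivity)
    fun u => platt2017_lemmaA8_abs hσ hm hh u

namespace Platt2017

/-- The inner integral of `I` is `e(−xt₀) F_H(x)` («Using the substitution `t → t + t₀` the inner
integral looks exactly like the definition of `F(x)` with `H` taking the place of `h`»), so it has the
modulus of `F_H(x)`. [cite: Platt2017, Lemma C.1 p. 2464 (proof)] -/
theorem norm_fourierW_eq (t₀ H x : ℝ) :
    ‖∫ t : ℝ, (π : ℂ) ^ (-(I * (t : ℝ) / 2)) * Complex.Gamma ((1 / 2 + (t : ℝ) * I) / 2) *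
        riemannZeta (1 / 2 + (t : ℝ) * I) *
        Complex.exp ((π * t / 4 - (t - t₀) ^ 2 / (2 * H ^ 2) : ℝ) : ℂ) *
        Complex.exp (-(2 * π * x * t : ℝ) * I)‖ = ‖(∫ t : ℝ, (π : ℂ) ^ (-(I * (t + t₀ : ℝ) / 2)) * Complex.Gamma ((1 / 2 + (t + t₀ : ℝ) * I) / 2) *
        riemannZeta (1 / 2 + (t + t₀ : ℝ) * I) *
        Complex.exp ((π * (t + t₀) / 4 - t ^ 2 / (2 * H ^ 2) : ℝ) : ℂ) *
        Complex.exp (-(2 * π * t * x : ℝ) * I))‖ := by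
  rw [← integral_add_right_eq_self (μ := volume) (fun t : ℝ => (π : ℂ) ^ (-(I * (t : ℝ) / 2)) *
        Complex.Gamma ((1 / 2 + (t : ℝ) * I) / 2) * riemannZeta (1 / 2 + (t : ℝ) * I) *
        Complex.exp ((π * t / 4 - (t - t₀) ^ 2 / (2 * H ^ 2) : ℝ) : ℂ) *
        Complex.exp (-(2 * π * x * t : ℝ) * I)) t₀]
  have hpt : ∀ t : ℝ, (π : ℂ) ^ (-(I * ((t + t₀ : ℝ) : ℂ) / 2)) *
      Complex.Gamma ((1 / 2 + ((t + t₀ : ℝ) : ℂ) * I) / 2) * riemannZeta (1 / 2 + ((t + t₀ : ℝ) : ℂ) * I) *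
      Complex.exp ((π * (t + t₀) / 4 - (t + t₀ - t₀) ^ 2 / (2 * H ^ 2) : ℝ) : ℂ) *
      Complex.exp (-(2 * π * x * (t + t₀) : ℝ) * I) =
      Complex.exp (-(2 * π * x * t₀ : ℝ) * I) * ((π : ℂ) ^ (-(I * (t + t₀ : ℝ) / 2)) * Complex.Gamma ((1 / 2 + (t + t₀ : ℝ) * I) / 2) *
        riemannZeta (1 / 2 + (t + t₀ : ℝ) * I) *
        Complex.exp ((π * (t + t₀) / 4 - t ^ 2 / (2 * H ^ 2) : ℝ) : ℂ) *
        Complex.exp (-(2 * π * t * x : ℝ) * I)) := by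
    intro t
    have e1 : Complex.exp ((π * (t + t₀) / 4 - (t + t₀ - t₀) ^ 2 / (2 * H ^ 2) : ℝ) : ℂ) =
        Complex.exp ((π * (t + t₀) / 4 - t ^ 2 / (2 * H ^ 2) : ℝ) : ℂ) := by
      congr 2; ring
    have e2 : Complex.exp (-(2 * π * x * (t + t₀) : ℝ) * I) =
        Complex.exp (-(2 * π * x * t₀ : ℝ) * I) * Complex.exp (-(2 * π * t * x : ℝ) * I) := by
      rw [← Complex.exp_add]; congr 1; push_cast; ring
    rw [e1, e2]; ring
  rw [show (fun t : ℝ => (π : ℂ) ^ (-(I * ((t + t₀ : ℝ) : ℂ) / 2)) *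
      Complex.Gamma ((1 / 2 + ((t + t₀ : ℝ) : ℂ) * I) / 2) * riemannZeta (1 / 2 + ((t + t₀ : ℝ) : ℂ) * I) *
      Complex.exp ((π * (t + t₀) / 4 - (t + t₀ - t₀) ^ 2 / (2 * H ^ 2) : ℝ) : ℂ) *
      Complex.exp (-(2 * π * x * (t + t₀) : ℝ) * I)) = fun t : ℝ => Complex.exp (-(2 * π * x * t₀ : ℝ) * I) * ((π : ℂ) ^ (-(I * (t + t₀ : ℝ) / 2)) * Complex.Gamma ((1 / 2 + (t + t₀ : ℝ) * I) / 2) *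
        riemannZeta (1 / 2 + (t + t₀ : ℝ) * I) *
        Complex.exp ((π * (t + t₀) / 4 - t ^ 2 / (2 * H ^ 2) : ℝ) : ℂ) *
        Complex.exp (-(2 * π * t * x : ℝ) * I))
    from funext hpt, integral_const_mul, norm_mul]
  have hn : ‖Complex.exp (-(2 * π * x * t₀ : ℝ) * I)‖ = 1 := by
    rw [Complex.norm_exp]
    simp
  rw [hn, one_mul]

end Platt2017

open Platt2017 in
/-- **Platt 2017, Lemma C.1 (p. 2464), PROVED as printed** (its input Lemma A.8 now being a theorem):
«Define `I` by `I := 4∫_{A/2}^∞ |∫_{−∞}^{∞} W(t) e(−xt) dt| dx`. Then we have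
`I ≤ 4ζ(σ)/(2σ−1) π^{(−3−2σ)/4} C(σ,t₀,H,0) exp((2σ−1)²/(8H²) − πA(2σ−1)/2)
+ 8π^{1/4} exp((1−4t₀²)/(8H²) − πA/2)`. *Proof.* Using the substitution `t → t + t₀` the inner integral
looks exactly like the definition of `F(x)` with `H` taking the place of `h`. We bound this using Lemma
A.8 and the outer integral is then trivial.» `W(t) = Λ(t) exp(πt/4 − (t−t₀)²/(2H²))` (p. 2464) is
written out; `σ = 2m+1 ≥ 3`, `H > 0`, any real `A`; the constant is written as
`4ζ(σ)π^{(1−2σ)/4}C/((2σ−1)π)` `= 4ζ(σ)/(2σ−1) · π^{(−3−2σ)/4} C` (`π^{(1−2σ)/4}/π = π^{(−3−2σ)/4}`).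
`platt2017_lemmaC1_of_bound` fed with `Platt2017.norm_fourierW_eq` and `platt2017_lemmaA8_abs`.
[cite: Platt2017, Lemma C.1 p. 2464] -/
theorem platt2017_lemmaC1 {σ t₀ H A : ℝ} {m : ℕ} (hσ : σ = 2 * m + 1) (hm : 1 ≤ m) (hH : 0 < H) :
    4 * ∫ x in Ioi (A / 2), ‖∫ t : ℝ, (π : ℂ) ^ (-(I * (t : ℝ) / 2)) *
        Complex.Gamma ((1 / 2 + (t : ℝ) * I) / 2) * riemannZeta (1 / 2 + (t : ℝ) * I) *
        Complex.exp ((π * t / 4 - (t - t₀) ^ 2 / (2 * H ^ 2) : ℝ) : ℂ) *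
        Complex.exp (-(2 * π * x * t : ℝ) * I)‖ ≤
      4 * ((riemannZeta (σ : ℂ)).re * π ^ ((1 - 2 * σ) / 4) * (∫ t : ℝ, ‖Complex.Gamma ((σ + (t + t₀) * I) / 2)‖ *
            Real.exp (π * (t + t₀) / 4 - t ^ 2 / (2 * H ^ 2)))) / ((2 * σ - 1) * π) *
          Real.exp ((2 * σ - 1) ^ 2 / (8 * H ^ 2) - π * A * (2 * σ - 1) / 2) +
        8 * π ^ (1 / 4 : ℝ) * Real.exp ((1 - 4 * t₀ ^ 2) / (8 * H ^ 2) - π * A / 2) := by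
  have hm1 : (1 : ℝ) ≤ m := by exact_mod_cast hm
  have hσ1 : 1 / 2 < σ := by rw [hσ]; linarith
  have hζ0 : 0 ≤ (riemannZeta (σ : ℂ)).re := by
    have := norm_riemannZeta_le_re_riemannZeta (s := (σ : ℂ)) (by simp; rw [hσ]; linarith)
    simp only [Complex.ofReal_re] at this
    exact (norm_nonneg _).trans this
  have hC0 : 0 ≤ (∫ t : ℝ, ‖Complex.Gamma ((σ + (t + t₀) * I) / 2)‖ *
            Real.exp (π * (t + t₀) / 4 - t ^ 2 / (2 * H ^ 2))) := integral_nonneg fun t => by positivity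
  refine platt2017_lemmaC1_of_bound (FW := fun x : ℝ => ∫ t : ℝ, (π : ℂ) ^ (-(I * (t : ℝ) / 2)) *
        Complex.Gamma ((1 / 2 + (t : ℝ) * I) / 2) * riemannZeta (1 / 2 + (t : ℝ) * I) *
        Complex.exp ((π * t / 4 - (t - t₀) ^ 2 / (2 * H ^ 2) : ℝ) : ℂ) *
        Complex.exp (-(2 * π * x * t : ℝ) * I)) hσ1 (by positivity) fun x => ?_
  rw [norm_fourierW_eq t₀ H x]
  exact platt2017_lemmaA8_abs (h := H) hσ hm hH x


/-! ### Lemma A.6 two-sided (with an honest constant) and Lemma A.7 -/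

open Platt2017 in
/-- **Platt 2017, Lemma A.6 (p. 2460) in its printed two-sided shape, PROVED with the constant
`max(C₊, C₋)` in place of Platt's `C(σ,t₀,h,k)`:** for `σ = 2m+1`, `h > 0` and every real `u`,
`|G^{(k)}(u)| ≤ max(C₊,C₋) exp((2σ+1)²/(8h²) − (2σ−1)π|u|)
+ 2^{k+2}π^{k+1} exp(−t₀²/(2h²)) Σ_{l=0}^{(σ−1)/2} ((2l+1/2)²+t₀²)^{k/2}/l! exp((4l+1)²/(8h²) − (4l+1)π|u|)`,
where `C₊ = (2π)^k ∫|Γ((σ+i(t+t₀))/2)| e^{π(t+t₀)/4 − t²/(2h²)} |1/2−σ−it|^k dt` is the right-shift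
constant of display (A.1) (`platt2017_lemmaA6_right`, case `u ≥ 0`; `(2σ−1)² ≤ (2σ+1)²`) and
`C₋ = (2π)^k ∫|Γ((−σ+i(t+t₀))/2)| e^{π(t+t₀)/4 − t²/(2h²)} |σ+1/2−it|^k dt` the left-shift constant
(`platt2017_lemmaA6_left`, case `u < 0`; `(2σ+1)πu ≤ −(2σ−1)π|u|`). In print both are replaced by
`C(σ,t₀,h,k) = (2π)^k ∫|Γ((σ+i(t+t₀))/2)| e^{…} |1/2+σ−it|^k dt` (p. 2457) through the closing sentence
of the proof «for our range of `σ` and for `t ∈ ℝ`, we have `|Γ(−σ/2+it)| < |Γ(σ/2+it)|`», which is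
false for small `|t|` (e.g. `Γ(−3/2) = 4√π/3 > Γ(3/2)`); the statement here is what the printed proof
proves. [cite: Platt2017, Lemma A.6 p. 2460 (statement and proof)] -/
theorem platt2017_lemmaA6 (k : ℕ) {σ t₀ h : ℝ} {m : ℕ} (hσ : σ = 2 * m + 1) (hh : 0 < h) (u : ℝ) :
    ‖(∫ t : ℝ, Complex.Gamma ((1 / 2 + (t + t₀) * I) / 2) *
        Complex.exp ((π * (t + t₀) / 4 - t ^ 2 / (2 * h ^ 2) : ℝ) : ℂ) * (-(2 * π * t : ℝ) * I) ^ k *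
        Complex.exp (-(2 * π * t * u : ℝ) * I))‖ ≤
      max ((2 * π) ^ k * ∫ t : ℝ, ‖Complex.Gamma ((σ + (t + t₀) * I) / 2)‖ *
          Real.exp (π * (t + t₀) / 4 - t ^ 2 / (2 * h ^ 2)) * ‖((1 / 2 - σ : ℝ) : ℂ) - t * I‖ ^ k) ((2 * π) ^ k * ∫ t : ℝ, ‖Complex.Gamma ((-σ + (t + t₀) * I) / 2)‖ *
          Real.exp (π * (t + t₀) / 4 - t ^ 2 / (2 * h ^ 2)) * ‖((σ + 1 / 2 : ℝ) : ℂ) - t * I‖ ^ k) * Real.exp ((2 * σ + 1) ^ 2 / (8 * h ^ 2) - (2 * σ - 1) * π * |u|) +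
        2 ^ (k + 2) * π ^ (k + 1) * Real.exp (-(t₀ ^ 2 / (2 * h ^ 2))) *
          ∑ l ∈ Finset.range (m + 1), ((2 * l + 1 / 2) ^ 2 + t₀ ^ 2) ^ ((k : ℝ) / 2) / (l.factorial : ℝ) *
            Real.exp ((4 * l + 1) ^ 2 / (8 * h ^ 2) - (4 * l + 1) * π * |u|) := by
  have hm0 : (0 : ℝ) ≤ m := Nat.cast_nonneg m
  have hσ1 : 1 ≤ σ := by rw [hσ]; linarith
  have hπ0 : 0 < π := Real.pi_pos
  have hIp : 0 ≤ ∫ t : ℝ, ‖Complex.Gamma ((σ + (t + t₀) * I) / 2)‖ *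
      Real.exp (π * (t + t₀) / 4 - t ^ 2 / (2 * h ^ 2)) * ‖((1 / 2 - σ : ℝ) : ℂ) - t * I‖ ^ k :=
    integral_nonneg fun t => by positivity
  have hIm : 0 ≤ ∫ t : ℝ, ‖Complex.Gamma ((-σ + (t + t₀) * I) / 2)‖ *
      Real.exp (π * (t + t₀) / 4 - t ^ 2 / (2 * h ^ 2)) * ‖((σ + 1 / 2 : ℝ) : ℂ) - t * I‖ ^ k :=
    integral_nonneg fun t => by positivity
  have hR : ∀ v : ℝ, 0 ≤ 2 ^ (k + 2) * π ^ (k + 1) * Real.exp (-(t₀ ^ 2 / (2 * h ^ 2))) *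
          ∑ l ∈ Finset.range (m + 1), ((2 * l + 1 / 2) ^ 2 + t₀ ^ 2) ^ ((k : ℝ) / 2) / (l.factorial : ℝ) *
            Real.exp ((4 * l + 1) ^ 2 / (8 * h ^ 2) - (4 * l + 1) * π * v) := fun v => by
    apply mul_nonneg (by positivity)
    exact Finset.sum_nonneg fun l _ => by positivity
  rcases le_or_gt 0 u with hu | hu
  · have hA := platt2017_lemmaA6_right k (σ := σ) (t₀ := t₀) (by linarith) hh hu
    rw [abs_of_nonneg hu]
    have he : Real.exp ((2 * σ - 1) ^ 2 / (8 * h ^ 2) - π * u * (2 * σ - 1)) ≤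
        Real.exp ((2 * σ + 1) ^ 2 / (8 * h ^ 2) - (2 * σ - 1) * π * u) := by
      apply Real.exp_le_exp.mpr
      have h1 : (2 * σ - 1) ^ 2 ≤ (2 * σ + 1) ^ 2 := by nlinarith
      have h2 : (2 * σ - 1) ^ 2 / (8 * h ^ 2) ≤ (2 * σ + 1) ^ 2 / (8 * h ^ 2) :=
        div_le_div_of_nonneg_right h1 (by positivity)
      nlinarith
    calc ‖(∫ t : ℝ, Complex.Gamma ((1 / 2 + (t + t₀) * I) / 2) *
        Complex.exp ((π * (t + t₀) / 4 - t ^ 2 / (2 * h ^ 2) : ℝ) : ℂ) * (-(2 * π * t : ℝ) * I) ^ k *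
        Complex.exp (-(2 * π * t * u : ℝ) * I))‖
        ≤ Real.exp ((2 * σ - 1) ^ 2 / (8 * h ^ 2) - π * u * (2 * σ - 1)) * ((2 * π) ^ k * ∫ t : ℝ, ‖Complex.Gamma ((σ + (t + t₀) * I) / 2)‖ *
          Real.exp (π * (t + t₀) / 4 - t ^ 2 / (2 * h ^ 2)) * ‖((1 / 2 - σ : ℝ) : ℂ) - t * I‖ ^ k) := by
          rw [← mul_assoc]; exact hA
      _ ≤ Real.exp ((2 * σ + 1) ^ 2 / (8 * h ^ 2) - (2 * σ - 1) * π * u) * max ((2 * π) ^ k * ∫ t : ℝ, ‖Complex.Gamma ((σ + (t + t₀) * I) / 2)‖ *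
          Real.exp (π * (t + t₀) / 4 - t ^ 2 / (2 * h ^ 2)) * ‖((1 / 2 - σ : ℝ) : ℂ) - t * I‖ ^ k) ((2 * π) ^ k * ∫ t : ℝ, ‖Complex.Gamma ((-σ + (t + t₀) * I) / 2)‖ *
          Real.exp (π * (t + t₀) / 4 - t ^ 2 / (2 * h ^ 2)) * ‖((σ + 1 / 2 : ℝ) : ℂ) - t * I‖ ^ k) + 2 ^ (k + 2) * π ^ (k + 1) * Real.exp (-(t₀ ^ 2 / (2 * h ^ 2))) *
          ∑ l ∈ Finset.range (m + 1), ((2 * l + 1 / 2) ^ 2 + t₀ ^ 2) ^ ((k : ℝ) / 2) / (l.factorial : ℝ) *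
            Real.exp ((4 * l + 1) ^ 2 / (8 * h ^ 2) - (4 * l + 1) * π * u) := by
          have h1 : Real.exp ((2 * σ - 1) ^ 2 / (8 * h ^ 2) - π * u * (2 * σ - 1)) * ((2 * π) ^ k * ∫ t : ℝ, ‖Complex.Gamma ((σ + (t + t₀) * I) / 2)‖ *
          Real.exp (π * (t + t₀) / 4 - t ^ 2 / (2 * h ^ 2)) * ‖((1 / 2 - σ : ℝ) : ℂ) - t * I‖ ^ k) ≤
              Real.exp ((2 * σ + 1) ^ 2 / (8 * h ^ 2) - (2 * σ - 1) * π * u) * max ((2 * π) ^ k * ∫ t : ℝ, ‖Complex.Gamma ((σ + (t + t₀) * I) / 2)‖ *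
          Real.exp (π * (t + t₀) / 4 - t ^ 2 / (2 * h ^ 2)) * ‖((1 / 2 - σ : ℝ) : ℂ) - t * I‖ ^ k) ((2 * π) ^ k * ∫ t : ℝ, ‖Complex.Gamma ((-σ + (t + t₀) * I) / 2)‖ *
          Real.exp (π * (t + t₀) / 4 - t ^ 2 / (2 * h ^ 2)) * ‖((σ + 1 / 2 : ℝ) : ℂ) - t * I‖ ^ k) :=
            mul_le_mul he (le_max_left _ _) (by positivity) (by positivity)
          linarith [hR u]
      _ = _ := by ring
  · have hA := platt2017_lemmaA6_left k (t₀ := t₀) hσ hh u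
    rw [abs_of_neg hu]
    have he : Real.exp ((2 * σ + 1) ^ 2 / (8 * h ^ 2) + (2 * σ + 1) * π * u) ≤
        Real.exp ((2 * σ + 1) ^ 2 / (8 * h ^ 2) - (2 * σ - 1) * π * -u) := by
      apply Real.exp_le_exp.mpr
      have : π * u < 0 := mul_neg_of_pos_of_neg hπ0 hu
      nlinarith
    have hres : 2 ^ (k + 2) * π ^ (k + 1) * Real.exp (-(t₀ ^ 2 / (2 * h ^ 2))) *
          ∑ l ∈ Finset.range (m + 1), ((2 * l + 1 / 2) ^ 2 + t₀ ^ 2) ^ ((k : ℝ) / 2) / (l.factorial : ℝ) *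
            Real.exp ((4 * l + 1) ^ 2 / (8 * h ^ 2) + (4 * l + 1) * π * u) = 2 ^ (k + 2) * π ^ (k + 1) * Real.exp (-(t₀ ^ 2 / (2 * h ^ 2))) *
          ∑ l ∈ Finset.range (m + 1), ((2 * l + 1 / 2) ^ 2 + t₀ ^ 2) ^ ((k : ℝ) / 2) / (l.factorial : ℝ) *
            Real.exp ((4 * l + 1) ^ 2 / (8 * h ^ 2) - (4 * l + 1) * π * -u) := by
      congr 1
      refine Finset.sum_congr rfl fun l _ => ?_
      congr 2
      ring
    calc ‖(∫ t : ℝ, Complex.Gamma ((1 / 2 + (t + t₀) * I) / 2) *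
        Complex.exp ((π * (t + t₀) / 4 - t ^ 2 / (2 * h ^ 2) : ℝ) : ℂ) * (-(2 * π * t : ℝ) * I) ^ k *
        Complex.exp (-(2 * π * t * u : ℝ) * I))‖
        ≤ Real.exp ((2 * σ + 1) ^ 2 / (8 * h ^ 2) + (2 * σ + 1) * π * u) * ((2 * π) ^ k * ∫ t : ℝ, ‖Complex.Gamma ((-σ + (t + t₀) * I) / 2)‖ *
          Real.exp (π * (t + t₀) / 4 - t ^ 2 / (2 * h ^ 2)) * ‖((σ + 1 / 2 : ℝ) : ℂ) - t * I‖ ^ k) + 2 ^ (k + 2) * π ^ (k + 1) * Real.exp (-(t₀ ^ 2 / (2 * h ^ 2))) *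
          ∑ l ∈ Finset.range (m + 1), ((2 * l + 1 / 2) ^ 2 + t₀ ^ 2) ^ ((k : ℝ) / 2) / (l.factorial : ℝ) *
            Real.exp ((4 * l + 1) ^ 2 / (8 * h ^ 2) + (4 * l + 1) * π * u) := by
          rw [← mul_assoc]; exact hA
      _ ≤ Real.exp ((2 * σ + 1) ^ 2 / (8 * h ^ 2) - (2 * σ - 1) * π * -u) * max ((2 * π) ^ k * ∫ t : ℝ, ‖Complex.Gamma ((σ + (t + t₀) * I) / 2)‖ *
          Real.exp (π * (t + t₀) / 4 - t ^ 2 / (2 * h ^ 2)) * ‖((1 / 2 - σ : ℝ) : ℂ) - t * I‖ ^ k) ((2 * π) ^ k * ∫ t : ℝ, ‖Complex.Gamma ((-σ + (t + t₀) * I) / 2)‖ *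
          Real.exp (π * (t + t₀) / 4 - t ^ 2 / (2 * h ^ 2)) * ‖((σ + 1 / 2 : ℝ) : ℂ) - t * I‖ ^ k) + 2 ^ (k + 2) * π ^ (k + 1) * Real.exp (-(t₀ ^ 2 / (2 * h ^ 2))) *
          ∑ l ∈ Finset.range (m + 1), ((2 * l + 1 / 2) ^ 2 + t₀ ^ 2) ^ ((k : ℝ) / 2) / (l.factorial : ℝ) *
            Real.exp ((4 * l + 1) ^ 2 / (8 * h ^ 2) - (4 * l + 1) * π * -u) := by
          rw [← hres]
          have h1 : Real.exp ((2 * σ + 1) ^ 2 / (8 * h ^ 2) + (2 * σ + 1) * π * u) * ((2 * π) ^ k * ∫ t : ℝ, ‖Complex.Gamma ((-σ + (t + t₀) * I) / 2)‖ *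
          Real.exp (π * (t + t₀) / 4 - t ^ 2 / (2 * h ^ 2)) * ‖((σ + 1 / 2 : ℝ) : ℂ) - t * I‖ ^ k) ≤
              Real.exp ((2 * σ + 1) ^ 2 / (8 * h ^ 2) - (2 * σ - 1) * π * -u) * max ((2 * π) ^ k * ∫ t : ℝ, ‖Complex.Gamma ((σ + (t + t₀) * I) / 2)‖ *
          Real.exp (π * (t + t₀) / 4 - t ^ 2 / (2 * h ^ 2)) * ‖((1 / 2 - σ : ℝ) : ℂ) - t * I‖ ^ k) ((2 * π) ^ k * ∫ t : ℝ, ‖Complex.Gamma ((-σ + (t + t₀) * I) / 2)‖ *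
          Real.exp (π * (t + t₀) / 4 - t ^ 2 / (2 * h ^ 2)) * ‖((σ + 1 / 2 : ℝ) : ℂ) - t * I‖ ^ k) :=
            mul_le_mul he (le_max_right _ _) (by positivity) (by positivity)
          linarith
      _ = _ := by ring

open Platt2017 in
/-- **Platt 2017, Lemma A.7 (pp. 2460–2461), PROVED with the constant `max(C₊,C₋)` in place of
`C(σ,t₀,h,k)`** (see `platt2017_lemmaA6`): «Let `m ∈ [0,N/2]` and `σ ∈ 2ℤ_{>0}+1`. Then we have
`|Σ_{l∈ℤ≠0} G^{(k)}(m/B + lA)| ≤ 2^{k+3}π^{k+1} exp(−t₀²/(2h²)) S + 2(1 + 1/(Aπ(2σ−1))) C(σ,t₀,h,k)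
exp((2σ+1)²/(8h²) − Aπ(2σ−1)/2)` where `S` is the sum
`Σ_{l=0}^{(σ−1)/2} (1 + 1/(Aπ(4l+1))) ((2l+1/2)²+t₀²)^{k/2}/l! exp((4l+1)²/(8h²) − Aπ(4l+1)/2)`.»
(the aliasing error of step (4)); `x` real with `|x| ≤ A/2` in place of `m/B`, `A > 0`, `h > 0`,
`G^{(k)}(u) = ∫ g(t;k) e(−tu) dt` written out; `platt2017_lemmaA7_of_bound` fed with
`platt2017_lemmaA6`. [cite: Platt2017, Lemma A.7 pp. 2460–2461] -/
theorem platt2017_lemmaA7 (k : ℕ) {σ t₀ h A x : ℝ} {m : ℕ} (hσ : σ = 2 * m + 1) (hh : 0 < h)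
    (hA : 0 < A) (hx : |x| ≤ A / 2) :
    Summable (fun n : ℤ => (∫ t : ℝ, Complex.Gamma ((1 / 2 + (t + t₀) * I) / 2) *
        Complex.exp ((π * (t + t₀) / 4 - t ^ 2 / (2 * h ^ 2) : ℝ) : ℂ) * (-(2 * π * t : ℝ) * I) ^ k *
        Complex.exp (-(2 * π * t * (x + n * A) : ℝ) * I))) ∧
      ‖∑' n : ℤ, (∫ t : ℝ, Complex.Gamma ((1 / 2 + (t + t₀) * I) / 2) *
        Complex.exp ((π * (t + t₀) / 4 - t ^ 2 / (2 * h ^ 2) : ℝ) : ℂ) * (-(2 * π * t : ℝ) * I) ^ k *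
        Complex.exp (-(2 * π * t * (x + n * A) : ℝ) * I)) - (∫ t : ℝ, Complex.Gamma ((1 / 2 + (t + t₀) * I) / 2) *
        Complex.exp ((π * (t + t₀) / 4 - t ^ 2 / (2 * h ^ 2) : ℝ) : ℂ) * (-(2 * π * t : ℝ) * I) ^ k *
        Complex.exp (-(2 * π * t * x : ℝ) * I))‖ ≤
        2 ^ (k + 3) * π ^ (k + 1) * Real.exp (-(t₀ ^ 2 / (2 * h ^ 2))) *
            ∑ l ∈ Finset.range (m + 1), (1 + 1 / (A * π * (4 * l + 1))) *
              (((2 * l + 1 / 2) ^ 2 + t₀ ^ 2) ^ ((k : ℝ) / 2) / (l.factorial : ℝ)) *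
              Real.exp ((4 * l + 1) ^ 2 / (8 * h ^ 2) - A * π * (4 * l + 1) / 2) +
          2 * (1 + 1 / (A * π * (2 * σ - 1))) * max ((2 * π) ^ k * ∫ t : ℝ, ‖Complex.Gamma ((σ + (t + t₀) * I) / 2)‖ *
          Real.exp (π * (t + t₀) / 4 - t ^ 2 / (2 * h ^ 2)) * ‖((1 / 2 - σ : ℝ) : ℂ) - t * I‖ ^ k) ((2 * π) ^ k * ∫ t : ℝ, ‖Complex.Gamma ((-σ + (t + t₀) * I) / 2)‖ *
          Real.exp (π * (t + t₀) / 4 - t ^ 2 / (2 * h ^ 2)) * ‖((σ + 1 / 2 : ℝ) : ℂ) - t * I‖ ^ k) *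
            Real.exp ((2 * σ + 1) ^ 2 / (8 * h ^ 2) - A * π * (2 * σ - 1) / 2) := by
  have hIp : 0 ≤ ∫ t : ℝ, ‖Complex.Gamma ((σ + (t + t₀) * I) / 2)‖ *
      Real.exp (π * (t + t₀) / 4 - t ^ 2 / (2 * h ^ 2)) * ‖((1 / 2 - σ : ℝ) : ℂ) - t * I‖ ^ k :=
    integral_nonneg fun t => by positivity
  have hC : 0 ≤ max ((2 * π) ^ k * ∫ t : ℝ, ‖Complex.Gamma ((σ + (t + t₀) * I) / 2)‖ *
          Real.exp (π * (t + t₀) / 4 - t ^ 2 / (2 * h ^ 2)) * ‖((1 / 2 - σ : ℝ) : ℂ) - t * I‖ ^ k) ((2 * π) ^ k * ∫ t : ℝ, ‖Complex.Gamma ((-σ + (t + t₀) * I) / 2)‖ *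
          Real.exp (π * (t + t₀) / 4 - t ^ 2 / (2 * h ^ 2)) * ‖((σ + 1 / 2 : ℝ) : ℂ) - t * I‖ ^ k) := le_max_of_le_left (by positivity)
  exact platt2017_lemmaA7_of_bound k (G := fun u : ℝ => (∫ t : ℝ, Complex.Gamma ((1 / 2 + (t + t₀) * I) / 2) *
        Complex.exp ((π * (t + t₀) / 4 - t ^ 2 / (2 * h ^ 2) : ℝ) : ℂ) * (-(2 * π * t : ℝ) * I) ^ k *
        Complex.exp (-(2 * π * t * u : ℝ) * I))) hσ hA hx hC
    fun u => platt2017_lemmaA6 k hσ hh u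


/-! ### Lemma B.2: the bound for `sup |G^{(K)}| ξ^K/K!` -/

open Platt2017 in
/-- **Platt 2017, Lemma B.2 (p. 2464) — its analytic chain after the Taylor-remainder step, PROVED:**
for every `u'`, `ξ ≥ 0`, `h > 0`,
`|G^{(K)}(u')| ξ^K/K! = |∫ g(t;K) ξ^K e(−u't)/K! dt| ≤ 8∫_0^∞ (2πtξ)^K/K! exp(−t²/(2h²)) dt
= 2^{(3K+5)/2} π^K ξ^K h^{K+1} Γ((K+1)/2)/Γ(K+1) ≤ 2^{(K+5)/2} π^{K+1/2} h^{K+1} ξ^K/Γ((K+2)/2)`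
(«and the result follows from the duplication formula for `Γ`»; the tree's right-hand side has the
exponent `K + 5/2 ≥ (K+5)/2`, see `platt2017_lemmaB2_duplication`). Here
`g(t;K) = (−2πit)^K Γ((1/2+i(t+t₀))/2) e^{π(t+t₀)/4 − t²/(2h²)}` and `|g(t;0)| < 4e^{−t²/(2h²)}`
(Lemma A.4, `Platt2017.norm_Gamma_half_line_mul_exp_lt_four`); `platt2017_lemmaB2_of_bound` does the
rest. NOT typed: the first step `|Σ_{k≥K} G^{(k)}(u)w^k/k!| ≤ sup_{u'} |G^{(K)}(u')| ξ^K/K!`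
(Taylor's theorem for the entire function `G`). [cite: Platt2017, Lemma B.2 p. 2464 (proof)] -/
theorem platt2017_lemmaB2_tail (K : ℕ) {h ξ : ℝ} (t₀ u : ℝ) (hh : 0 < h) (hξ : 0 ≤ ξ) :
    ‖(∫ t : ℝ, Complex.Gamma ((1 / 2 + (t + t₀) * I) / 2) *
        Complex.exp ((π * (t + t₀) / 4 - t ^ 2 / (2 * h ^ 2) : ℝ) : ℂ) * (-(2 * π * t : ℝ) * I) ^ K *
        Complex.exp (-(2 * π * t * u : ℝ) * I))‖ * ξ ^ K / (K.factorial : ℝ) ≤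
      (2 : ℝ) ^ ((K : ℝ) + 5 / 2) * π ^ ((K : ℝ) + 1 / 2) * h ^ (K + 1) * ξ ^ K /
        Real.Gamma (((K : ℝ) + 2) / 2) := by
  have hg : ∀ t : ℝ, ‖Complex.Gamma ((1 / 2 + (t + t₀) * I) / 2) *
      Complex.exp ((π * (t + t₀) / 4 - t ^ 2 / (2 * h ^ 2) : ℝ) : ℂ) * (-(2 * π * t : ℝ) * I) ^ K *
      Complex.exp (-(2 * π * t * u : ℝ) * I)‖ ≤ 4 * (2 * π * |t|) ^ K * Real.exp (-(t ^ 2 / (2 * h ^ 2))) := by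
    intro t
    have h4 := norm_Gamma_half_line_mul_exp_lt_four (t + t₀)
    push_cast at h4
    have n1 : ‖Complex.exp (((π * (t + t₀) / 4 - t ^ 2 / (2 * h ^ 2) : ℝ)) : ℂ)‖ =
        Real.exp (π * (t + t₀) / 4) * Real.exp (-(t ^ 2 / (2 * h ^ 2))) := by
      rw [Complex.norm_exp_ofReal, ← Real.exp_add, ← sub_eq_add_neg]
    have n2 : ‖Complex.exp (-((2 * π * t * u : ℝ) : ℂ) * I)‖ = 1 := by
      rw [← Complex.ofReal_neg, Complex.norm_exp_ofReal_mul_I]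
    have n3 : ‖(-((2 * π * t : ℝ) : ℂ) * I) ^ K‖ = (2 * π * |t|) ^ K := by
      rw [norm_pow, norm_mul, norm_neg, Complex.norm_real, Complex.norm_I, mul_one, Real.norm_eq_abs,
        abs_mul, abs_of_pos (by positivity : (0 : ℝ) < 2 * π)]
    rw [norm_mul, norm_mul, norm_mul, n1, n2, n3, mul_one]
    have h0 : 0 ≤ (2 * π * |t|) ^ K * Real.exp (-(t ^ 2 / (2 * h ^ 2))) := by positivity
    calc ‖Complex.Gamma ((1 / 2 + ((t : ℂ) + (t₀ : ℂ)) * I) / 2)‖ *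
          (Real.exp (π * (t + t₀) / 4) * Real.exp (-(t ^ 2 / (2 * h ^ 2)))) * (2 * π * |t|) ^ K
        = ‖Complex.Gamma ((1 / 2 + ((t : ℂ) + (t₀ : ℂ)) * I) / 2)‖ * Real.exp (π * (t + t₀) / 4) *
            ((2 * π * |t|) ^ K * Real.exp (-(t ^ 2 / (2 * h ^ 2)))) := by ring
      _ ≤ 4 * ((2 * π * |t|) ^ K * Real.exp (-(t ^ 2 / (2 * h ^ 2)))) :=
          mul_le_mul_of_nonneg_right h4.le h0
      _ = _ := by ring
  have hB := platt2017_lemmaB2_of_bound K hh hξ (w := ξ) (by rw [abs_of_nonneg hξ]) hg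
  rw [abs_of_nonneg hξ] at hB
  refine le_trans ?_ hB
  have e : ‖(∫ t : ℝ, Complex.Gamma ((1 / 2 + (t + t₀) * I) / 2) *
        Complex.exp ((π * (t + t₀) / 4 - t ^ 2 / (2 * h ^ 2) : ℝ) : ℂ) * (-(2 * π * t : ℝ) * I) ^ K *
        Complex.exp (-(2 * π * t * u : ℝ) * I))‖ * ξ ^ K / (K.factorial : ℝ) = ‖∫ t : ℝ, Complex.Gamma ((1 / 2 + (t + t₀) * I) / 2) *
      Complex.exp ((π * (t + t₀) / 4 - t ^ 2 / (2 * h ^ 2) : ℝ) : ℂ) * (-(2 * π * t : ℝ) * I) ^ K *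
      Complex.exp (-(2 * π * t * u : ℝ) * I) * ((ξ ^ K / (K.factorial : ℝ) : ℝ) : ℂ)‖ := by
    rw [integral_mul_const, norm_mul, Complex.norm_real, Real.norm_eq_abs,
      abs_of_nonneg (by positivity)]
    ring
  rw [e]
  refine (norm_integral_le_integral_norm _).trans (le_of_eq ?_)
  refine integral_congr_ae (ae_of_all _ fun t => ?_)
  beta_reduce
  rw [norm_mul, Complex.norm_real, Real.norm_eq_abs, abs_of_nonneg (by positivity)]
  ring


/-! ### Lemma B.2 in full: the Taylor tail of `G` -/

namespace Platt2017

/-- `d/dφ (e^{iφ} − Σ_{k≤K} (iφ)^k/k!) = i (e^{iφ} − Σ_{k<K} (iφ)^k/k!)`. [folklore] -/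
private theorem hasDerivAt_expTaylorTail (K : ℕ) (φ : ℝ) :
    HasDerivAt (fun φ : ℝ => Complex.exp (I * φ) -
        ∑ k ∈ Finset.range (K + 1), (I * φ) ^ k / (k.factorial : ℂ))
      (I * (Complex.exp (I * φ) - ∑ k ∈ Finset.range K, (I * φ) ^ k / (k.factorial : ℂ))) φ := by
  have h1 : HasDerivAt (fun φ : ℝ => I * (φ : ℂ)) I φ := by
    simpa using ((hasDerivAt_id φ).ofReal_comp).const_mul I
  have hexp : HasDerivAt (fun φ : ℝ => Complex.exp (I * φ)) (Complex.exp (I * φ) * I) φ := h1.cexp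
  have hpow : ∀ k ∈ Finset.range (K + 1), HasDerivAt (fun φ : ℝ => (I * (φ : ℂ)) ^ k / (k.factorial : ℂ))
      ((k : ℂ) * (I * φ) ^ (k - 1) * I / (k.factorial : ℂ)) φ := fun k _ => (h1.pow k).div_const _
  have hsum := HasDerivAt.fun_sum hpow
  have hre : ∑ k ∈ Finset.range (K + 1), (k : ℂ) * (I * φ) ^ (k - 1) * I / (k.factorial : ℂ) =
      I * ∑ k ∈ Finset.range K, (I * φ) ^ k / (k.factorial : ℂ) := by
    rw [Finset.sum_range_succ', Finset.mul_sum]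
    simp only [Nat.cast_zero, zero_mul, zero_div, add_zero, Nat.succ_sub_one]
    refine Finset.sum_congr rfl fun k _ => ?_
    have hk : ((k + 1).factorial : ℂ) = (k + 1) * (k.factorial : ℂ) := by
      rw [Nat.factorial_succ]; push_cast; ring
    have hk0 : (k.factorial : ℂ) ≠ 0 := by exact_mod_cast k.factorial_ne_zero
    have hk1 : ((k : ℂ) + 1) ≠ 0 := by exact_mod_cast Nat.succ_ne_zero k
    rw [hk]; push_cast; field_simp
  have h2 := hexp.sub hsum
  rw [hre] at h2
  have e : Complex.exp (I * φ) * I - I * ∑ k ∈ Finset.range K, (I * (φ : ℂ)) ^ k / (k.factorial : ℂ) =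
      I * (Complex.exp (I * φ) - ∑ k ∈ Finset.range K, (I * (φ : ℂ)) ^ k / (k.factorial : ℂ)) := by ring
  rw [e] at h2
  exact h2

/-- **`|e^{iθ} − Σ_{k<K} (iθ)^k/k!| ≤ |θ|^K/K!` for `θ ≥ 0`** (induction, integrating the previous case).
[folklore] -/
private theorem norm_expTaylorTail_le_of_nonneg : ∀ (K : ℕ) (θ : ℝ), 0 ≤ θ →
    ‖Complex.exp (I * θ) - ∑ k ∈ Finset.range K, (I * θ) ^ k / (k.factorial : ℂ)‖ ≤
      θ ^ K / (K.factorial : ℝ)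
  | 0, θ, _ => by simp [Complex.norm_exp]
  | K + 1, θ, hθ => by
      have hcontK : Continuous fun φ : ℝ => I * (Complex.exp (I * φ) -
          ∑ k ∈ Finset.range K, (I * φ) ^ k / (k.factorial : ℂ)) := by fun_prop
      have hFTC := intervalIntegral.integral_eq_sub_of_hasDerivAt (a := 0) (b := θ)
        (fun φ _ => hasDerivAt_expTaylorTail K φ) (hcontK.intervalIntegrable 0 θ)
      have h0 : (fun φ : ℝ => Complex.exp (I * φ) -
          ∑ k ∈ Finset.range (K + 1), (I * φ) ^ k / (k.factorial : ℂ)) 0 = 0 := by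
        simp [Finset.sum_range_succ']
      simp only [h0, sub_zero] at hFTC
      rw [← hFTC]
      calc ‖∫ φ in (0 : ℝ)..θ, I * (Complex.exp (I * φ) - ∑ k ∈ Finset.range K, (I * φ) ^ k / (k.factorial : ℂ))‖
          ≤ ∫ φ in (0 : ℝ)..θ, ‖I * (Complex.exp (I * φ) - ∑ k ∈ Finset.range K, (I * φ) ^ k / (k.factorial : ℂ))‖ :=
            intervalIntegral.norm_integral_le_integral_norm hθ
        _ ≤ ∫ φ in (0 : ℝ)..θ, φ ^ K / (K.factorial : ℝ) := by
            refine intervalIntegral.integral_mono_on hθ (hcontK.norm.intervalIntegrable 0 θ)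
              ((continuous_pow K).div_const _ |>.intervalIntegrable 0 θ) fun φ hφ => ?_
            rw [norm_mul, Complex.norm_I, one_mul]
            exact norm_expTaylorTail_le_of_nonneg K φ hφ.1
        _ = θ ^ (K + 1) / ((K + 1).factorial : ℝ) := by
            rw [intervalIntegral.integral_div, integral_pow, Nat.factorial_succ]
            push_cast
            have hk0 : (K.factorial : ℝ) ≠ 0 := by exact_mod_cast K.factorial_ne_zero
            field_simp
            ring

/-- **`|e^{iθ} − Σ_{k<K} (iθ)^k/k!| ≤ |θ|^K/K!` for every real `θ`** (the sharp Taylor remainder on the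
imaginary axis; `θ < 0` by complex conjugation). [folklore] -/
private theorem norm_expTaylorTail_le (K : ℕ) (θ : ℝ) :
    ‖Complex.exp (I * θ) - ∑ k ∈ Finset.range K, (I * θ) ^ k / (k.factorial : ℂ)‖ ≤
      |θ| ^ K / (K.factorial : ℝ) := by
  rcases le_or_gt 0 θ with hθ | hθ
  · rw [abs_of_nonneg hθ]; exact norm_expTaylorTail_le_of_nonneg K θ hθ
  · have h := norm_expTaylorTail_le_of_nonneg K (-θ) (by linarith)
    rw [abs_of_neg hθ]
    have hconj : Complex.exp (I * θ) - ∑ k ∈ Finset.range K, (I * θ) ^ k / (k.factorial : ℂ) =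
        conj (Complex.exp (I * ((-θ : ℝ) : ℂ)) -
          ∑ k ∈ Finset.range K, (I * ((-θ : ℝ) : ℂ)) ^ k / (k.factorial : ℂ)) := by
      rw [map_sub, ← Complex.exp_conj, map_sum]
      have hc : conj (I * ((-θ : ℝ) : ℂ)) = I * θ := by
        rw [map_mul, Complex.conj_I, Complex.conj_ofReal]; push_cast; ring
      rw [hc]
      congr 1
      refine Finset.sum_congr rfl fun k _ => ?_
      rw [map_div₀, map_pow, hc, map_natCast]
    rw [hconj, Complex.norm_conj]
    exact h

end Platt2017


open Platt2017 in
/-- **Platt 2017, Lemma B.2 (p. 2464), PROVED:** «Let `w ∈ [−ξ, ξ]`. Then we have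
`|Σ_{k=K}^∞ G^{(k)}(u) w^k/k!| ≤ 2^{(K+5)/2} π^{K+1/2} h^{K+1} ξ^K / Γ((K+2)/2)`.
*Proof.* `|Σ_{k≥K} G^{(k)}(u)w^k/k!| ≤ sup_{u'∈(u−ξ,u+ξ]} |G^{(K)}(u') ξ^K/K!| ≤ sup |∫ g(t;K) ξ^K e(−u't)/K! dt|
≤ 8∫_0^∞ (2πtξ)^K/K! exp(−t²/(2h²)) dt = 2^{(3K+5)/2} π^K ξ^K h^{K+1} Γ((K+1)/2)/Γ(K+1)`, and the result
follows from the duplication formula for `Γ`.» The Taylor tail `Σ_{k≥K} G^{(k)}(u)w^k/k!` is written as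
what it is, `G(u+w) − Σ_{k<K} G^{(k)}(u) w^k/k!`, with `G(v) = ∫ g(t;0) e(−tv) dt` and
`G^{(k)}(u) = ∫ g(t;k) e(−tu) dt`, `g(t;k) = (−2πit)^k Γ((1/2+i(t+t₀))/2) e^{π(t+t₀)/4 − t²/(2h²)}`
(steps (2)–(3), p. 2451) written out; `h > 0`, `|w| ≤ ξ`, any `u`, `t₀`; the right-hand side carries
the exponent `K + 5/2` of `platt2017_lemmaB2_of_bound` (weaker than the printed `(K+5)/2` by `2^{K/2}`;
the printed constant is `platt2017_lemmaB2_printed` below). The first inequality is done through the sharp remainder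
`|e(−tw) − Σ_{k<K} (−2πitw)^k/k!| ≤ |2πtw|^K/K!` (in-file `norm_expTaylorTail_le`, by induction on `K`
integrating the previous case — Mathlib's `Complex.exp_bound` is neither sharp nor global) inside the
Fourier integral — which is what «Taylor's theorem» gives here —, then Lemma A.4
(`|g(t;0)| < 4e^{−t²/(2h²)}`, `Platt2017.norm_Gamma_half_line_mul_exp_lt_four`) and
`platt2017_lemmaB2_of_bound` (moment `platt2017_lemmaB2_moment` + duplication).
[cite: Platt2017, Lemma B.2 p. 2464 (statement and proof)] -/
theorem platt2017_lemmaB2 (K : ℕ) {h ξ w : ℝ} (t₀ u : ℝ) (hh : 0 < h) (hξ : 0 ≤ ξ) (hw : |w| ≤ ξ) :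
    ‖(∫ t : ℝ, Complex.Gamma ((1 / 2 + (t + t₀) * I) / 2) *
          Complex.exp ((π * (t + t₀) / 4 - t ^ 2 / (2 * h ^ 2) : ℝ) : ℂ) *
          Complex.exp (-(2 * π * t * (u + w) : ℝ) * I)) -
        ∑ k ∈ Finset.range K, (((w ^ k / (k.factorial : ℝ) : ℝ)) : ℂ) * ∫ t : ℝ, Complex.Gamma ((1 / 2 + (t + t₀) * I) / 2) *
          Complex.exp ((π * (t + t₀) / 4 - t ^ 2 / (2 * h ^ 2) : ℝ) : ℂ) * (-(2 * π * t : ℝ) * I) ^ k *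
          Complex.exp (-(2 * π * t * u : ℝ) * I)‖ ≤
      (2 : ℝ) ^ ((K : ℝ) + 5 / 2) * π ^ ((K : ℝ) + 1 / 2) * h ^ (K + 1) * ξ ^ K /
        Real.Gamma (((K : ℝ) + 2) / 2) := by
  -- integrability of `g(t;k) e(−tv)`
  have hInt : ∀ (k : ℕ) (v : ℝ), Integrable fun t : ℝ => Complex.Gamma ((1 / 2 + (t + t₀) * I) / 2) *
          Complex.exp ((π * (t + t₀) / 4 - t ^ 2 / (2 * h ^ 2) : ℝ) : ℂ) * (-(2 * π * t : ℝ) * I) ^ k *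
          Complex.exp (-(2 * π * t * v : ℝ) * I) := by
    intro k v
    have h1 := (integrable_fourier_kernel_vertical' k (σ := 1 / 2) (t₀ := t₀) (h := h) v hh le_rfl
      le_rfl).comp_add_right t₀
    refine h1.congr (ae_of_all _ fun t => ?_)
    exact (fourier_kernel_eq k t₀ h v t).symm
  have hInt0 : Integrable fun t : ℝ => Complex.Gamma ((1 / 2 + (t + t₀) * I) / 2) *
          Complex.exp ((π * (t + t₀) / 4 - t ^ 2 / (2 * h ^ 2) : ℝ) : ℂ) *
          Complex.exp (-(2 * π * t * (u + w) : ℝ) * I) := by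
    refine (hInt 0 (u + w)).congr (ae_of_all _ fun t => ?_)
    simp only [pow_zero, mul_one]
  -- Lemma A.4: `|g(t;K) e(−tu)| ≤ 4 (2π|t|)^K e^{−t²/(2h²)}`
  have n3 : ∀ (k : ℕ) (t : ℝ), ‖(-((2 * π * t : ℝ) : ℂ) * I) ^ k‖ = (2 * π * |t|) ^ k := fun k t => by
    rw [norm_pow, norm_mul, norm_neg, Complex.norm_real, Complex.norm_I, mul_one, Real.norm_eq_abs,
      abs_mul, abs_of_pos (by positivity : (0 : ℝ) < 2 * π)]
  have hg : ∀ t : ℝ, ‖Complex.Gamma ((1 / 2 + (t + t₀) * I) / 2) *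
          Complex.exp ((π * (t + t₀) / 4 - t ^ 2 / (2 * h ^ 2) : ℝ) : ℂ) * (-(2 * π * t : ℝ) * I) ^ K *
          Complex.exp (-(2 * π * t * u : ℝ) * I)‖ ≤ 4 * (2 * π * |t|) ^ K * Real.exp (-(t ^ 2 / (2 * h ^ 2))) := by
    intro t
    have h4 := norm_Gamma_half_line_mul_exp_lt_four (t + t₀)
    push_cast at h4
    have n1 : ‖Complex.exp (((π * (t + t₀) / 4 - t ^ 2 / (2 * h ^ 2) : ℝ)) : ℂ)‖ =
        Real.exp (π * (t + t₀) / 4) * Real.exp (-(t ^ 2 / (2 * h ^ 2))) := by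
      rw [Complex.norm_exp_ofReal, ← Real.exp_add, ← sub_eq_add_neg]
    have n2 : ‖Complex.exp (-((2 * π * t * u : ℝ) : ℂ) * I)‖ = 1 := by
      rw [← Complex.ofReal_neg, Complex.norm_exp_ofReal_mul_I]
    rw [norm_mul, norm_mul, norm_mul, n1, n2, n3, mul_one]
    have h0 : 0 ≤ (2 * π * |t|) ^ K * Real.exp (-(t ^ 2 / (2 * h ^ 2))) := by positivity
    calc ‖Complex.Gamma ((1 / 2 + ((t : ℂ) + (t₀ : ℂ)) * I) / 2)‖ *
          (Real.exp (π * (t + t₀) / 4) * Real.exp (-(t ^ 2 / (2 * h ^ 2)))) * (2 * π * |t|) ^ K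
        = ‖Complex.Gamma ((1 / 2 + ((t : ℂ) + (t₀ : ℂ)) * I) / 2)‖ * Real.exp (π * (t + t₀) / 4) *
            ((2 * π * |t|) ^ K * Real.exp (-(t ^ 2 / (2 * h ^ 2)))) := by ring
      _ ≤ 4 * ((2 * π * |t|) ^ K * Real.exp (-(t ^ 2 / (2 * h ^ 2)))) :=
          mul_le_mul_of_nonneg_right h4.le h0
      _ = _ := by ring
  -- the Taylor tail of `e(−tw)`
  have hP : ∀ t : ℝ, ‖(Complex.exp (I * ((-(2 * π * t * w) : ℝ) : ℂ)) -
          ∑ k ∈ Finset.range K, (I * ((-(2 * π * t * w) : ℝ) : ℂ)) ^ k / (k.factorial : ℂ))‖ ≤ (2 * π * |t|) ^ K * |w| ^ K / (K.factorial : ℝ) := by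
    intro t
    have h1 := norm_expTaylorTail_le K (-(2 * π * t * w))
    have e : |-(2 * π * t * w)| = 2 * π * |t| * |w| := by
      rw [abs_neg, abs_mul, abs_mul, abs_of_pos (by positivity : (0 : ℝ) < 2 * π)]
    rw [e, mul_pow] at h1
    exact h1
  -- the pointwise identity of the integrand
  have hpt : ∀ t : ℝ, Complex.Gamma ((1 / 2 + (t + t₀) * I) / 2) *
          Complex.exp ((π * (t + t₀) / 4 - t ^ 2 / (2 * h ^ 2) : ℝ) : ℂ) *
          Complex.exp (-(2 * π * t * (u + w) : ℝ) * I) - ∑ k ∈ Finset.range K, (((w ^ k / (k.factorial : ℝ) : ℝ)) : ℂ) * (Complex.Gamma ((1 / 2 + (t + t₀) * I) / 2) *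
          Complex.exp ((π * (t + t₀) / 4 - t ^ 2 / (2 * h ^ 2) : ℝ) : ℂ) * (-(2 * π * t : ℝ) * I) ^ k *
          Complex.exp (-(2 * π * t * u : ℝ) * I)) = Complex.Gamma ((1 / 2 + (t + t₀) * I) / 2) *
          Complex.exp ((π * (t + t₀) / 4 - t ^ 2 / (2 * h ^ 2) : ℝ) : ℂ) *
          Complex.exp (-(2 * π * t * u : ℝ) * I) * (Complex.exp (I * ((-(2 * π * t * w) : ℝ) : ℂ)) -
          ∑ k ∈ Finset.range K, (I * ((-(2 * π * t * w) : ℝ) : ℂ)) ^ k / (k.factorial : ℂ)) := by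
    intro t
    rw [mul_sub, Finset.mul_sum]
    congr 1
    · rw [mul_assoc _ (Complex.exp (-((2 * π * t * u : ℝ) : ℂ) * I)), ← Complex.exp_add]
      congr 2
      push_cast
      ring
    · refine Finset.sum_congr rfl fun k _ => ?_
      push_cast
      ring
  -- `G(u+w) − Σ_{k<K} = ∫ g(t;0) e(−tu) P_K(t) dt`
  have hEq : (∫ t : ℝ, Complex.Gamma ((1 / 2 + (t + t₀) * I) / 2) *
          Complex.exp ((π * (t + t₀) / 4 - t ^ 2 / (2 * h ^ 2) : ℝ) : ℂ) *
          Complex.exp (-(2 * π * t * (u + w) : ℝ) * I)) - ∑ k ∈ Finset.range K, (((w ^ k / (k.factorial : ℝ) : ℝ)) : ℂ) * ∫ t : ℝ, Complex.Gamma ((1 / 2 + (t + t₀) * I) / 2) *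
          Complex.exp ((π * (t + t₀) / 4 - t ^ 2 / (2 * h ^ 2) : ℝ) : ℂ) * (-(2 * π * t : ℝ) * I) ^ k *
          Complex.exp (-(2 * π * t * u : ℝ) * I) =
      ∫ t : ℝ, Complex.Gamma ((1 / 2 + (t + t₀) * I) / 2) *
          Complex.exp ((π * (t + t₀) / 4 - t ^ 2 / (2 * h ^ 2) : ℝ) : ℂ) *
          Complex.exp (-(2 * π * t * u : ℝ) * I) * (Complex.exp (I * ((-(2 * π * t * w) : ℝ) : ℂ)) -
          ∑ k ∈ Finset.range K, (I * ((-(2 * π * t * w) : ℝ) : ℂ)) ^ k / (k.factorial : ℂ)) := by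
    have hs : ∑ k ∈ Finset.range K, (((w ^ k / (k.factorial : ℝ) : ℝ)) : ℂ) * ∫ t : ℝ, Complex.Gamma ((1 / 2 + (t + t₀) * I) / 2) *
          Complex.exp ((π * (t + t₀) / 4 - t ^ 2 / (2 * h ^ 2) : ℝ) : ℂ) * (-(2 * π * t : ℝ) * I) ^ k *
          Complex.exp (-(2 * π * t * u : ℝ) * I) =
        ∫ t : ℝ, ∑ k ∈ Finset.range K, (((w ^ k / (k.factorial : ℝ) : ℝ)) : ℂ) * (Complex.Gamma ((1 / 2 + (t + t₀) * I) / 2) *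
          Complex.exp ((π * (t + t₀) / 4 - t ^ 2 / (2 * h ^ 2) : ℝ) : ℂ) * (-(2 * π * t : ℝ) * I) ^ k *
          Complex.exp (-(2 * π * t * u : ℝ) * I)) := by
      rw [integral_finsetSum _ fun k _ => (hInt k u).const_mul _]
      exact Finset.sum_congr rfl fun k _ => (integral_const_mul _ _).symm
    rw [hs, ← integral_sub hInt0 (integrable_finsetSum _ fun k _ => (hInt k u).const_mul _)]
    exact integral_congr_ae (ae_of_all _ fun t => hpt t)
  rw [hEq]
  -- majorize and apply the moment computation
  have hmaj : ∀ t : ℝ, ‖Complex.Gamma ((1 / 2 + (t + t₀) * I) / 2) *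
          Complex.exp ((π * (t + t₀) / 4 - t ^ 2 / (2 * h ^ 2) : ℝ) : ℂ) *
          Complex.exp (-(2 * π * t * u : ℝ) * I) * (Complex.exp (I * ((-(2 * π * t * w) : ℝ) : ℂ)) -
          ∑ k ∈ Finset.range K, (I * ((-(2 * π * t * w) : ℝ) : ℂ)) ^ k / (k.factorial : ℂ))‖ ≤ ‖Complex.Gamma ((1 / 2 + (t + t₀) * I) / 2) *
          Complex.exp ((π * (t + t₀) / 4 - t ^ 2 / (2 * h ^ 2) : ℝ) : ℂ) * (-(2 * π * t : ℝ) * I) ^ K *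
          Complex.exp (-(2 * π * t * u : ℝ) * I)‖ * |w| ^ K / (K.factorial : ℝ) := by
    intro t
    have hn : ‖Complex.Gamma ((1 / 2 + (t + t₀) * I) / 2) *
          Complex.exp ((π * (t + t₀) / 4 - t ^ 2 / (2 * h ^ 2) : ℝ) : ℂ) * (-(2 * π * t : ℝ) * I) ^ K *
          Complex.exp (-(2 * π * t * u : ℝ) * I)‖ = ‖Complex.Gamma ((1 / 2 + (t + t₀) * I) / 2) *
          Complex.exp ((π * (t + t₀) / 4 - t ^ 2 / (2 * h ^ 2) : ℝ) : ℂ) *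
          Complex.exp (-(2 * π * t * u : ℝ) * I)‖ * (2 * π * |t|) ^ K := by
      rw [norm_mul, norm_mul, norm_mul, norm_mul, norm_mul, n3]; ring
    rw [norm_mul, hn]
    have h0 : 0 ≤ ‖Complex.Gamma ((1 / 2 + (t + t₀) * I) / 2) *
          Complex.exp ((π * (t + t₀) / 4 - t ^ 2 / (2 * h ^ 2) : ℝ) : ℂ) *
          Complex.exp (-(2 * π * t * u : ℝ) * I)‖ := norm_nonneg _
    calc ‖Complex.Gamma ((1 / 2 + (t + t₀) * I) / 2) *
          Complex.exp ((π * (t + t₀) / 4 - t ^ 2 / (2 * h ^ 2) : ℝ) : ℂ) *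
          Complex.exp (-(2 * π * t * u : ℝ) * I)‖ * ‖(Complex.exp (I * ((-(2 * π * t * w) : ℝ) : ℂ)) -
          ∑ k ∈ Finset.range K, (I * ((-(2 * π * t * w) : ℝ) : ℂ)) ^ k / (k.factorial : ℂ))‖ ≤ ‖Complex.Gamma ((1 / 2 + (t + t₀) * I) / 2) *
          Complex.exp ((π * (t + t₀) / 4 - t ^ 2 / (2 * h ^ 2) : ℝ) : ℂ) *
          Complex.exp (-(2 * π * t * u : ℝ) * I)‖ * ((2 * π * |t|) ^ K * |w| ^ K / (K.factorial : ℝ)) :=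
          mul_le_mul_of_nonneg_left (hP t) h0
      _ = _ := by ring
  have hB := platt2017_lemmaB2_of_bound K hh hξ hw hg
  refine le_trans ((norm_integral_le_integral_norm _).trans ?_) hB
  refine integral_mono_of_nonneg (ae_of_all _ fun t => norm_nonneg _) ?_ (ae_of_all _ fun t => hmaj t)
  exact ((hInt K u).norm.mul_const (|w| ^ K)).div_const _


/-! ### Theorem 5.1: the certified output of the algorithm (a named fact) -/

/-- **Platt 2017, Theorem 5.1 (p. 2456) — the paper's certified computational result, recorded as a
named fact:** «In all, we used approximately 63,000 CPU hours (…) and we performed approximately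
`6 × 10¹²` high precision evaluations of `ζ` and isolated 103,800,788,359 zeros with
`0 < ℑs < 30,610,046,000` to `±2^{−102}`. Turing's method confirms that these are the only zeros in that
range, so we have: **Theorem 5.1.** Let `ρ` be a non-trivial zero of the Riemann zeta function with
`|ℑρ| ≤ 3.0610046 × 10¹⁰`. Then `ρ` is simple and `ℜρ = 1/2`.» The proof in print is a rigorous
multi-precision interval-arithmetic computation (the windowed-FFT algorithm of §3, whose truncation,
aliasing and up-sampling error terms are the lemmas PROVED in this file and its two siblings
`CertifiedZetaIsolationBounds.lean` / `CertifiedZetaIsolationAliasingSums.lean`, plus Turing's method,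
Theorems 4.1–4.2 — the tree's `TuringMethod.lean`); it is instrument provenance for
`platt_trudgian_numerical_rh` ([PlattTrudgian2021, Thm 1], height `3·10¹²`, same software lineage),
which supersedes the `ℜρ = 1/2` half but not the simplicity. Here a non-trivial zero is a zero other
than `−2(n+1)`, `n ∈ ℕ`, and «simple» is `ζ'(ρ) ≠ 0` (`ζ` is analytic at every zero since `ρ ≠ 1`).
[cite: Platt2017, Theorem 5.1 p. 2456] -/
def platt2017_theorem51 : Prop :=
  ∀ ρ : ℂ, riemannZeta ρ = 0 → (∀ n : ℕ, ρ ≠ -2 * ((n : ℂ) + 1)) → |ρ.im| ≤ 30610046000 →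
    deriv riemannZeta ρ ≠ 0 ∧ ρ.re = 1 / 2

/-- The `ℜρ = 1/2` half of Theorem 5.1 in the shape of `platt_trudgian_numerical_rh` (zeros with
`ℑρ ≠ 0` are automatically non-trivial, the trivial zeros being real): every zero `β + iγ` of `ζ` with
`0 < γ ≤ 30 610 046 000` has `β = 1/2`. [cite: Platt2017, Theorem 5.1 p. 2456] -/
theorem platt2017_theorem51.rh_upTo (h : platt2017_theorem51) :
    ∀ s : ℂ, riemannZeta s = 0 → 0 < s.im → s.im ≤ 30610046000 → s.re = 1 / 2 := by
  intro s hs h0 hT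
  refine (h s hs (fun n hn => ?_) ?_).2
  · have := congrArg Complex.im hn
    simp at this
    linarith
  · rw [abs_of_pos h0]; exact hT

/-- The simplicity half of Theorem 5.1: every zero `ρ` of `ζ` with `0 < |ℑρ| ≤ 30 610 046 000` is
simple. [cite: Platt2017, Theorem 5.1 p. 2456] -/
theorem platt2017_theorem51.simple (h : platt2017_theorem51) :
    ∀ s : ℂ, riemannZeta s = 0 → s.im ≠ 0 → |s.im| ≤ 30610046000 → deriv riemannZeta s ≠ 0 := by
  intro s hs h0 hT
  refine (h s hs (fun n hn => ?_) hT).1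
  have := congrArg Complex.im hn
  simp at this
  exact h0 this


/-! ### Lemma B.2 with the printed constant `2^{(K+5)/2}` -/

/-- The majorant computation of Lemma B.2 with its EXACT value: if `|g(t)| ≤ 4(2π|t|)^K e^{−t²/(2h²)}`
and `|w| ≤ ξ` then `∫ |g(t)| |w|^K/K! dt ≤ 8∫_0^∞ (2πtξ)^K/K! e^{−t²/(2h²)} dt
= 2^{(3K+5)/2} π^K ξ^K h^{K+1} Γ((K+1)/2)/Γ(K+1) = 2^{(K+5)/2} π^{K+1/2} h^{K+1} ξ^K/Γ((K+2)/2)`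
(`platt2017_lemmaB2_of_bound` stops at the weaker `2^{K+5/2}`; same proof, ending with the equality
half of `platt2017_lemmaB2_duplication`). [cite: Platt2017, Lemma B.2 p. 2464 (proof)] -/
theorem platt2017_lemmaB2_of_bound_printed (K : ℕ) {h ξ w : ℝ} {g : ℝ → ℂ} (hh : 0 < h) (hξ : 0 ≤ ξ)
    (hw : |w| ≤ ξ) (hg : ∀ t : ℝ, ‖g t‖ ≤ 4 * (2 * π * |t|) ^ K * Real.exp (-(t ^ 2 / (2 * h ^ 2)))) :
    ∫ t : ℝ, ‖g t‖ * |w| ^ K / (K.factorial : ℝ) ≤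
      (2 : ℝ) ^ (((K : ℝ) + 5) / 2) * π ^ ((K : ℝ) + 1 / 2) * h ^ (K + 1) * ξ ^ K /
        Real.Gamma (((K : ℝ) + 2) / 2) := by
  set φ : ℝ → ℝ := fun s => (2 * π * s * ξ) ^ K / (K.factorial : ℝ) * Real.exp (-(s ^ 2 / (2 * h ^ 2)))
    with hφ
  have hφabs : ∀ t : ℝ, 4 * φ |t| = 4 * (2 * π * |t|) ^ K * Real.exp (-(t ^ 2 / (2 * h ^ 2))) * ξ ^ K /
      (K.factorial : ℝ) := fun t => by
    simp only [hφ, sq_abs, mul_pow]; ring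
  have hb : (0 : ℝ) < 1 / (2 * h ^ 2) := by positivity
  have hint : Integrable fun t : ℝ => t ^ (K : ℝ) * Real.exp (-(1 / (2 * h ^ 2)) * t ^ 2) :=
    integrable_rpow_mul_exp_neg_mul_sq hb (by have := Nat.cast_nonneg (α := ℝ) K; linarith)
  have hMint : Integrable fun t : ℝ => 4 * φ |t| := by
    have h1 : Integrable fun t : ℝ => |t| ^ K * Real.exp (-(t ^ 2 / (2 * h ^ 2))) := by
      refine (hint.norm).congr (ae_of_all _ fun t => ?_)
      simp only [Real.norm_eq_abs, Real.rpow_natCast, abs_mul, abs_pow, abs_of_pos (Real.exp_pos _)]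
      congr 2; ring
    refine (h1.const_mul (4 * (2 * π * ξ) ^ K / (K.factorial : ℝ))).congr (ae_of_all _ fun t => ?_)
    simp only [hφ, sq_abs, mul_pow]; ring
  have hdom : ∀ t : ℝ, ‖g t‖ * |w| ^ K / (K.factorial : ℝ) ≤ 4 * φ |t| := by
    intro t
    rw [hφabs]
    have hwK : |w| ^ K ≤ ξ ^ K := pow_le_pow_left₀ (abs_nonneg w) hw K
    have hfac : (0 : ℝ) < K.factorial := by exact_mod_cast Nat.factorial_pos K
    rw [div_le_div_iff_of_pos_right hfac]
    have h0 : 0 ≤ 4 * (2 * π * |t|) ^ K * Real.exp (-(t ^ 2 / (2 * h ^ 2))) := by positivity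
    calc ‖g t‖ * |w| ^ K ≤ (4 * (2 * π * |t|) ^ K * Real.exp (-(t ^ 2 / (2 * h ^ 2)))) * ξ ^ K :=
          mul_le_mul (hg t) hwK (pow_nonneg (abs_nonneg w) K) h0
      _ = 4 * (2 * π * |t|) ^ K * Real.exp (-(t ^ 2 / (2 * h ^ 2))) * ξ ^ K := by ring
  have hmono : ∫ t : ℝ, ‖g t‖ * |w| ^ K / (K.factorial : ℝ) ≤ ∫ t : ℝ, 4 * φ |t| :=
    integral_mono_of_nonneg (ae_of_all _ fun t => by positivity) hMint (ae_of_all _ hdom)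
  refine hmono.trans (le_of_eq ?_)
  have heven : ∫ t : ℝ, 4 * φ |t| = 8 * ∫ t in Ioi (0 : ℝ), φ t := by
    rw [integral_const_mul, integral_comp_abs (f := φ)]; ring
  rw [heven]
  simp only [hφ]
  rw [platt2017_lemmaB2_moment K hh ξ]
  exact (platt2017_lemmaB2_duplication K hh hξ).1

open Platt2017 in
/-- **Platt 2017, Lemma B.2 (p. 2464) with its printed constant:** for `|w| ≤ ξ`, `h > 0`,
`|G(u+w) − Σ_{k<K} G^{(k)}(u) w^k/k!| ≤ 2^{(K+5)/2} π^{K+1/2} h^{K+1} ξ^K / Γ((K+2)/2)` — the statement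
«`|Σ_{k=K}^∞ G^{(k)}(u) w^k/k!| ≤ 2^{(K+5)/2} π^{K+1/2} h^{K+1} ξ^K/Γ((K+2)/2)`» verbatim (the Taylor
tail written as `G(u+w)` minus the Taylor polynomial; see `platt2017_lemmaB2` for the conventions and the
proof, which is repeated here ending with `platt2017_lemmaB2_of_bound_printed`).
[cite: Platt2017, Lemma B.2 p. 2464] -/
theorem platt2017_lemmaB2_printed (K : ℕ) {h ξ w : ℝ} (t₀ u : ℝ) (hh : 0 < h) (hξ : 0 ≤ ξ)
    (hw : |w| ≤ ξ) :
    ‖(∫ t : ℝ, Complex.Gamma ((1 / 2 + (t + t₀) * I) / 2) *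
          Complex.exp ((π * (t + t₀) / 4 - t ^ 2 / (2 * h ^ 2) : ℝ) : ℂ) *
          Complex.exp (-(2 * π * t * (u + w) : ℝ) * I)) -
        ∑ k ∈ Finset.range K, (((w ^ k / (k.factorial : ℝ) : ℝ)) : ℂ) * ∫ t : ℝ, Complex.Gamma ((1 / 2 + (t + t₀) * I) / 2) *
          Complex.exp ((π * (t + t₀) / 4 - t ^ 2 / (2 * h ^ 2) : ℝ) : ℂ) * (-(2 * π * t : ℝ) * I) ^ k *
          Complex.exp (-(2 * π * t * u : ℝ) * I)‖ ≤
      (2 : ℝ) ^ (((K : ℝ) + 5) / 2) * π ^ ((K : ℝ) + 1 / 2) * h ^ (K + 1) * ξ ^ K /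
        Real.Gamma (((K : ℝ) + 2) / 2) := by
  have n3 : ∀ (k : ℕ) (t : ℝ), ‖(-((2 * π * t : ℝ) : ℂ) * I) ^ k‖ = (2 * π * |t|) ^ k := fun k t => by
    rw [norm_pow, norm_mul, norm_neg, Complex.norm_real, Complex.norm_I, mul_one, Real.norm_eq_abs,
      abs_mul, abs_of_pos (by positivity : (0 : ℝ) < 2 * π)]
  have hg : ∀ t : ℝ, ‖Complex.Gamma ((1 / 2 + (t + t₀) * I) / 2) *
          Complex.exp ((π * (t + t₀) / 4 - t ^ 2 / (2 * h ^ 2) : ℝ) : ℂ) * (-(2 * π * t : ℝ) * I) ^ K *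
          Complex.exp (-(2 * π * t * u : ℝ) * I)‖ ≤ 4 * (2 * π * |t|) ^ K * Real.exp (-(t ^ 2 / (2 * h ^ 2))) := by
    intro t
    have h4 := norm_Gamma_half_line_mul_exp_lt_four (t + t₀)
    push_cast at h4
    have n1 : ‖Complex.exp (((π * (t + t₀) / 4 - t ^ 2 / (2 * h ^ 2) : ℝ)) : ℂ)‖ =
        Real.exp (π * (t + t₀) / 4) * Real.exp (-(t ^ 2 / (2 * h ^ 2))) := by
      rw [Complex.norm_exp_ofReal, ← Real.exp_add, ← sub_eq_add_neg]
    have n2 : ‖Complex.exp (-((2 * π * t * u : ℝ) : ℂ) * I)‖ = 1 := by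
      rw [← Complex.ofReal_neg, Complex.norm_exp_ofReal_mul_I]
    rw [norm_mul, norm_mul, norm_mul, n1, n2, n3, mul_one]
    have h0 : 0 ≤ (2 * π * |t|) ^ K * Real.exp (-(t ^ 2 / (2 * h ^ 2))) := by positivity
    calc ‖Complex.Gamma ((1 / 2 + ((t : ℂ) + (t₀ : ℂ)) * I) / 2)‖ *
          (Real.exp (π * (t + t₀) / 4) * Real.exp (-(t ^ 2 / (2 * h ^ 2)))) * (2 * π * |t|) ^ K
        = ‖Complex.Gamma ((1 / 2 + ((t : ℂ) + (t₀ : ℂ)) * I) / 2)‖ * Real.exp (π * (t + t₀) / 4) *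
            ((2 * π * |t|) ^ K * Real.exp (-(t ^ 2 / (2 * h ^ 2)))) := by ring
      _ ≤ 4 * ((2 * π * |t|) ^ K * Real.exp (-(t ^ 2 / (2 * h ^ 2)))) :=
          mul_le_mul_of_nonneg_right h4.le h0
      _ = _ := by ring
  -- the chain of `platt2017_lemmaB2` up to `∫ |g(t;K) e(−tu)| |w|^K/K!`, then the printed constant
  have hInt : ∀ (k : ℕ) (v : ℝ), Integrable fun t : ℝ => Complex.Gamma ((1 / 2 + (t + t₀) * I) / 2) *
          Complex.exp ((π * (t + t₀) / 4 - t ^ 2 / (2 * h ^ 2) : ℝ) : ℂ) * (-(2 * π * t : ℝ) * I) ^ k *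
          Complex.exp (-(2 * π * t * v : ℝ) * I) := by
    intro k v
    have h1 := (integrable_fourier_kernel_vertical' k (σ := 1 / 2) (t₀ := t₀) (h := h) v hh le_rfl
      le_rfl).comp_add_right t₀
    refine h1.congr (ae_of_all _ fun t => ?_)
    exact (fourier_kernel_eq k t₀ h v t).symm
  have hInt0 : Integrable fun t : ℝ => Complex.Gamma ((1 / 2 + (t + t₀) * I) / 2) *
          Complex.exp ((π * (t + t₀) / 4 - t ^ 2 / (2 * h ^ 2) : ℝ) : ℂ) *
          Complex.exp (-(2 * π * t * (u + w) : ℝ) * I) := by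
    refine (hInt 0 (u + w)).congr (ae_of_all _ fun t => ?_)
    simp only [pow_zero, mul_one]
  have hP : ∀ t : ℝ, ‖(Complex.exp (I * ((-(2 * π * t * w) : ℝ) : ℂ)) -
          ∑ k ∈ Finset.range K, (I * ((-(2 * π * t * w) : ℝ) : ℂ)) ^ k / (k.factorial : ℂ))‖ ≤ (2 * π * |t|) ^ K * |w| ^ K / (K.factorial : ℝ) := by
    intro t
    have h1 := norm_expTaylorTail_le K (-(2 * π * t * w))
    have e : |-(2 * π * t * w)| = 2 * π * |t| * |w| := by
      rw [abs_neg, abs_mul, abs_mul, abs_of_pos (by positivity : (0 : ℝ) < 2 * π)]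
    rw [e, mul_pow] at h1
    exact h1
  have hpt : ∀ t : ℝ, Complex.Gamma ((1 / 2 + (t + t₀) * I) / 2) *
          Complex.exp ((π * (t + t₀) / 4 - t ^ 2 / (2 * h ^ 2) : ℝ) : ℂ) *
          Complex.exp (-(2 * π * t * (u + w) : ℝ) * I) - ∑ k ∈ Finset.range K, (((w ^ k / (k.factorial : ℝ) : ℝ)) : ℂ) * (Complex.Gamma ((1 / 2 + (t + t₀) * I) / 2) *
          Complex.exp ((π * (t + t₀) / 4 - t ^ 2 / (2 * h ^ 2) : ℝ) : ℂ) * (-(2 * π * t : ℝ) * I) ^ k *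
          Complex.exp (-(2 * π * t * u : ℝ) * I)) = Complex.Gamma ((1 / 2 + (t + t₀) * I) / 2) *
          Complex.exp ((π * (t + t₀) / 4 - t ^ 2 / (2 * h ^ 2) : ℝ) : ℂ) *
          Complex.exp (-(2 * π * t * u : ℝ) * I) * (Complex.exp (I * ((-(2 * π * t * w) : ℝ) : ℂ)) -
          ∑ k ∈ Finset.range K, (I * ((-(2 * π * t * w) : ℝ) : ℂ)) ^ k / (k.factorial : ℂ)) := by
    intro t
    rw [mul_sub, Finset.mul_sum]
    congr 1
    · rw [mul_assoc _ (Complex.exp (-((2 * π * t * u : ℝ) : ℂ) * I)), ← Complex.exp_add]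
      congr 2
      push_cast
      ring
    · refine Finset.sum_congr rfl fun k _ => ?_
      push_cast
      ring
  have hEq : (∫ t : ℝ, Complex.Gamma ((1 / 2 + (t + t₀) * I) / 2) *
          Complex.exp ((π * (t + t₀) / 4 - t ^ 2 / (2 * h ^ 2) : ℝ) : ℂ) *
          Complex.exp (-(2 * π * t * (u + w) : ℝ) * I)) - ∑ k ∈ Finset.range K, (((w ^ k / (k.factorial : ℝ) : ℝ)) : ℂ) * ∫ t : ℝ, Complex.Gamma ((1 / 2 + (t + t₀) * I) / 2) *
          Complex.exp ((π * (t + t₀) / 4 - t ^ 2 / (2 * h ^ 2) : ℝ) : ℂ) * (-(2 * π * t : ℝ) * I) ^ k *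
          Complex.exp (-(2 * π * t * u : ℝ) * I) =
      ∫ t : ℝ, Complex.Gamma ((1 / 2 + (t + t₀) * I) / 2) *
          Complex.exp ((π * (t + t₀) / 4 - t ^ 2 / (2 * h ^ 2) : ℝ) : ℂ) *
          Complex.exp (-(2 * π * t * u : ℝ) * I) * (Complex.exp (I * ((-(2 * π * t * w) : ℝ) : ℂ)) -
          ∑ k ∈ Finset.range K, (I * ((-(2 * π * t * w) : ℝ) : ℂ)) ^ k / (k.factorial : ℂ)) := by
    have hs : ∑ k ∈ Finset.range K, (((w ^ k / (k.factorial : ℝ) : ℝ)) : ℂ) * ∫ t : ℝ, Complex.Gamma ((1 / 2 + (t + t₀) * I) / 2) *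
          Complex.exp ((π * (t + t₀) / 4 - t ^ 2 / (2 * h ^ 2) : ℝ) : ℂ) * (-(2 * π * t : ℝ) * I) ^ k *
          Complex.exp (-(2 * π * t * u : ℝ) * I) =
        ∫ t : ℝ, ∑ k ∈ Finset.range K, (((w ^ k / (k.factorial : ℝ) : ℝ)) : ℂ) * (Complex.Gamma ((1 / 2 + (t + t₀) * I) / 2) *
          Complex.exp ((π * (t + t₀) / 4 - t ^ 2 / (2 * h ^ 2) : ℝ) : ℂ) * (-(2 * π * t : ℝ) * I) ^ k *
          Complex.exp (-(2 * π * t * u : ℝ) * I)) := by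
      rw [integral_finsetSum _ fun k _ => (hInt k u).const_mul _]
      exact Finset.sum_congr rfl fun k _ => (integral_const_mul _ _).symm
    rw [hs, ← integral_sub hInt0 (integrable_finsetSum _ fun k _ => (hInt k u).const_mul _)]
    exact integral_congr_ae (ae_of_all _ fun t => hpt t)
  rw [hEq]
  have hmaj : ∀ t : ℝ, ‖Complex.Gamma ((1 / 2 + (t + t₀) * I) / 2) *
          Complex.exp ((π * (t + t₀) / 4 - t ^ 2 / (2 * h ^ 2) : ℝ) : ℂ) *
          Complex.exp (-(2 * π * t * u : ℝ) * I) * (Complex.exp (I * ((-(2 * π * t * w) : ℝ) : ℂ)) -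
          ∑ k ∈ Finset.range K, (I * ((-(2 * π * t * w) : ℝ) : ℂ)) ^ k / (k.factorial : ℂ))‖ ≤ ‖Complex.Gamma ((1 / 2 + (t + t₀) * I) / 2) *
          Complex.exp ((π * (t + t₀) / 4 - t ^ 2 / (2 * h ^ 2) : ℝ) : ℂ) * (-(2 * π * t : ℝ) * I) ^ K *
          Complex.exp (-(2 * π * t * u : ℝ) * I)‖ * |w| ^ K / (K.factorial : ℝ) := by
    intro t
    have hn : ‖Complex.Gamma ((1 / 2 + (t + t₀) * I) / 2) *
          Complex.exp ((π * (t + t₀) / 4 - t ^ 2 / (2 * h ^ 2) : ℝ) : ℂ) * (-(2 * π * t : ℝ) * I) ^ K *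
          Complex.exp (-(2 * π * t * u : ℝ) * I)‖ = ‖Complex.Gamma ((1 / 2 + (t + t₀) * I) / 2) *
          Complex.exp ((π * (t + t₀) / 4 - t ^ 2 / (2 * h ^ 2) : ℝ) : ℂ) *
          Complex.exp (-(2 * π * t * u : ℝ) * I)‖ * (2 * π * |t|) ^ K := by
      rw [norm_mul, norm_mul, norm_mul, norm_mul, norm_mul, n3]; ring
    rw [norm_mul, hn]
    have h0 : 0 ≤ ‖Complex.Gamma ((1 / 2 + (t + t₀) * I) / 2) *
          Complex.exp ((π * (t + t₀) / 4 - t ^ 2 / (2 * h ^ 2) : ℝ) : ℂ) *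
          Complex.exp (-(2 * π * t * u : ℝ) * I)‖ := norm_nonneg _
    calc ‖Complex.Gamma ((1 / 2 + (t + t₀) * I) / 2) *
          Complex.exp ((π * (t + t₀) / 4 - t ^ 2 / (2 * h ^ 2) : ℝ) : ℂ) *
          Complex.exp (-(2 * π * t * u : ℝ) * I)‖ * ‖(Complex.exp (I * ((-(2 * π * t * w) : ℝ) : ℂ)) -
          ∑ k ∈ Finset.range K, (I * ((-(2 * π * t * w) : ℝ) : ℂ)) ^ k / (k.factorial : ℂ))‖ ≤ ‖Complex.Gamma ((1 / 2 + (t + t₀) * I) / 2) *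
          Complex.exp ((π * (t + t₀) / 4 - t ^ 2 / (2 * h ^ 2) : ℝ) : ℂ) *
          Complex.exp (-(2 * π * t * u : ℝ) * I)‖ * ((2 * π * |t|) ^ K * |w| ^ K / (K.factorial : ℝ)) :=
          mul_le_mul_of_nonneg_left (hP t) h0
      _ = _ := by ring
  have hB := platt2017_lemmaB2_of_bound_printed K hh hξ hw hg
  refine le_trans ((norm_integral_le_integral_norm _).trans ?_) hB
  refine integral_mono_of_nonneg (ae_of_all _ fun t => norm_nonneg _) ?_ (ae_of_all _ fun t => hmaj t)
  exact ((hInt K u).norm.mul_const (|w| ^ K)).div_const _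


/-! ### (3.2) as used: the Taylor truncation of the `j`-series, `J` terms weighted by `1/√j` -/

open Platt2017 in
/-- **Platt 2017, Lemma 3.3 / display (3.2) in the truncated form the algorithm uses (pp. 2453, 2464),
PROVED:** expanding each `G(x + log(j√π)/(2π))`, `j ≤ J`, of Lemma 3.2's series to order `K` about a
centre `x + v_j` with `|log(j√π)/(2π) − v_j| ≤ ξ` («`S_m^{(k)}` is defined for `ξ = 1/(2B)` via the `j`
with `log(j√π)/(2π) ∈ [u_m − ξ, u_m + ξ)`», so `v_j = u_m` for those `j`; «This is a simple application
of Taylor's theorem») costs, by Lemma B.2 for each `j` and «Since this error term occurs `J` times in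
(3.2), weighted by `1/√j` each time, we multiply it by `2√J − 1`» (p. 2464), at most
`(2√J − 1) · 2^{(K+5)/2} π^{K+1/2} h^{K+1} ξ^K / Γ((K+2)/2)`:
`|Σ_{j=1}^{J} (1/√j)(j√π)^{−it₀} [G(x + L_j) − Σ_{k<K} G^{(k)}(x + v_j)(L_j − v_j)^k/k!]| ≤ (2√J−1)·(B.2)`,
`L_j = log(j√π)/(2π)`, `G`, `G^{(k)}` the integrals of steps (2)–(3) written out. The centres `v_j` are
arbitrary reals within `ξ` of `L_j` (in print the grid points `u_m = m/B`); regrouping the finite double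
sum by centre is display (3.2). (`platt2017_lemmaB2_printed`, `platt2017_sum_inv_sqrt_le`.)
[cite: Platt2017, Lemma 3.3 p. 2453; Appendix B p. 2464 (remark after Lemma B.2)] -/
theorem platt2017_eq32_taylor_truncation (J K : ℕ) {h ξ : ℝ} (t₀ x : ℝ) (v : ℕ → ℝ) (hJ : 1 ≤ J)
    (hh : 0 < h) (hξ : 0 ≤ ξ) (hv : ∀ j ∈ Finset.Icc 1 J, |(Real.log ((j : ℝ) * Real.sqrt π) / (2 * π)) - v j| ≤ ξ) :
    ‖∑ j ∈ Finset.Icc 1 J, (((1 / Real.sqrt (j : ℝ) : ℝ) : ℂ) * (((j : ℝ) * Real.sqrt π : ℝ) : ℂ) ^ (-(I * t₀))) *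
        ((∫ t : ℝ, Complex.Gamma ((1 / 2 + (t + t₀) * I) / 2) *
          Complex.exp ((π * (t + t₀) / 4 - t ^ 2 / (2 * h ^ 2) : ℝ) : ℂ) *
          Complex.exp (-(2 * π * t * (x + (Real.log ((j : ℝ) * Real.sqrt π) / (2 * π))) : ℝ) * I)) -
          ∑ k ∈ Finset.range K, (((((Real.log ((j : ℝ) * Real.sqrt π) / (2 * π)) - v j) ^ k / (k.factorial : ℝ) : ℝ)) : ℂ) * ∫ t : ℝ, Complex.Gamma ((1 / 2 + (t + t₀) * I) / 2) *
          Complex.exp ((π * (t + t₀) / 4 - t ^ 2 / (2 * h ^ 2) : ℝ) : ℂ) * (-(2 * π * t : ℝ) * I) ^ k *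
          Complex.exp (-(2 * π * t * (x + v j) : ℝ) * I))‖ ≤
      (2 * Real.sqrt J - 1) *
        ((2 : ℝ) ^ (((K : ℝ) + 5) / 2) * π ^ ((K : ℝ) + 1 / 2) * h ^ (K + 1) * ξ ^ K /
          Real.Gamma (((K : ℝ) + 2) / 2)) := by
  set B : ℝ := (2 : ℝ) ^ (((K : ℝ) + 5) / 2) * π ^ ((K : ℝ) + 1 / 2) * h ^ (K + 1) * ξ ^ K /
    Real.Gamma (((K : ℝ) + 2) / 2) with hB
  have hB0 : 0 ≤ B := by
    have := Real.Gamma_pos_of_pos (by positivity : (0 : ℝ) < ((K : ℝ) + 2) / 2)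
    positivity
  refine (norm_sum_le _ _).trans ?_
  have hterm : ∀ j ∈ Finset.Icc 1 J, ‖(((1 / Real.sqrt (j : ℝ) : ℝ) : ℂ) * (((j : ℝ) * Real.sqrt π : ℝ) : ℂ) ^ (-(I * t₀))) *
      ((∫ t : ℝ, Complex.Gamma ((1 / 2 + (t + t₀) * I) / 2) *
          Complex.exp ((π * (t + t₀) / 4 - t ^ 2 / (2 * h ^ 2) : ℝ) : ℂ) *
          Complex.exp (-(2 * π * t * (x + (Real.log ((j : ℝ) * Real.sqrt π) / (2 * π))) : ℝ) * I)) -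
        ∑ k ∈ Finset.range K, (((((Real.log ((j : ℝ) * Real.sqrt π) / (2 * π)) - v j) ^ k / (k.factorial : ℝ) : ℝ)) : ℂ) * ∫ t : ℝ, Complex.Gamma ((1 / 2 + (t + t₀) * I) / 2) *
          Complex.exp ((π * (t + t₀) / 4 - t ^ 2 / (2 * h ^ 2) : ℝ) : ℂ) * (-(2 * π * t : ℝ) * I) ^ k *
          Complex.exp (-(2 * π * t * (x + v j) : ℝ) * I))‖ ≤ 1 / Real.sqrt j * B := by
    intro j hj
    have hj1 : 1 ≤ j := (Finset.mem_Icc.mp hj).1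
    have hj0 : (0 : ℝ) < j := by exact_mod_cast hj1
    have hnπ : 0 < (j : ℝ) * Real.sqrt π := by positivity
    have hc : ‖(((1 / Real.sqrt (j : ℝ) : ℝ) : ℂ) * (((j : ℝ) * Real.sqrt π : ℝ) : ℂ) ^ (-(I * t₀)))‖ = 1 / Real.sqrt j := by
      rw [norm_mul, Complex.norm_cpow_eq_rpow_re_of_pos hnπ, Complex.norm_real, Real.norm_eq_abs,
        abs_of_pos (by positivity)]
      simp
    rw [norm_mul, hc]
    refine mul_le_mul_of_nonneg_left ?_ (by positivity)
    have h2 := platt2017_lemmaB2_printed K t₀ (x + v j) hh hξ (hv j hj) (w := (Real.log ((j : ℝ) * Real.sqrt π) / (2 * π)) - v j)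
    have e : x + v j + ((Real.log ((j : ℝ) * Real.sqrt π) / (2 * π)) - v j) = x + (Real.log ((j : ℝ) * Real.sqrt π) / (2 * π)) := by ring
    rw [e] at h2
    exact h2
  calc ∑ j ∈ Finset.Icc 1 J, ‖(((1 / Real.sqrt (j : ℝ) : ℝ) : ℂ) * (((j : ℝ) * Real.sqrt π : ℝ) : ℂ) ^ (-(I * t₀))) *
        ((∫ t : ℝ, Complex.Gamma ((1 / 2 + (t + t₀) * I) / 2) *
          Complex.exp ((π * (t + t₀) / 4 - t ^ 2 / (2 * h ^ 2) : ℝ) : ℂ) *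
          Complex.exp (-(2 * π * t * (x + (Real.log ((j : ℝ) * Real.sqrt π) / (2 * π))) : ℝ) * I)) -
          ∑ k ∈ Finset.range K, (((((Real.log ((j : ℝ) * Real.sqrt π) / (2 * π)) - v j) ^ k / (k.factorial : ℝ) : ℝ)) : ℂ) * ∫ t : ℝ, Complex.Gamma ((1 / 2 + (t + t₀) * I) / 2) *
          Complex.exp ((π * (t + t₀) / 4 - t ^ 2 / (2 * h ^ 2) : ℝ) : ℂ) * (-(2 * π * t : ℝ) * I) ^ k *
          Complex.exp (-(2 * π * t * (x + v j) : ℝ) * I))‖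
      ≤ ∑ j ∈ Finset.Icc 1 J, 1 / Real.sqrt j * B := Finset.sum_le_sum hterm
    _ = (∑ j ∈ Finset.Icc 1 J, 1 / Real.sqrt j) * B := by rw [Finset.sum_mul]
    _ ≤ (2 * Real.sqrt J - 1) * B :=
        mul_le_mul_of_nonneg_right (platt2017_sum_inv_sqrt_le hJ) hB0


open Platt2017 in
/-- **Display (3.2) (Lemma 3.3, p. 2453) as a finite regrouping:** with the `j ≤ J` bucketed by
`m(j)` onto grid points `u_{m}` («`S^{(k)}_m := Σ_{log(j√π)/(2π) ∈ [u_m−ξ, u_m+ξ)} (1/√j)(j√π)^{−it₀}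
(log(j√π)/(2π) − u_m)^k`»), the order-`K` Taylor polynomials of the `j`-series regroup as
`Σ_{j≤J} (1/√j)(j√π)^{−it₀} Σ_{k<K} G^{(k)}(x+u_{m(j)}) (L_j − u_{m(j)})^k/k!
= Σ_{k<K} Σ_m G^{(k)}(x+u_m)/k! · S^{(k)}_m` — «for each `k`, (3.2) is a discrete convolution» —;
pure finite bookkeeping (`Finset.sum_comm`, `Finset.sum_fiberwise_of_maps_to`), the analytic content being
`platt2017_eq32_taylor_truncation` (and Lemma 3.2, B.1 for the `j > J` tail). The bucketing `m` and the
grid `u` are arbitrary here. [cite: Platt2017, Lemma 3.3 and display (3.2) p. 2453] -/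
theorem platt2017_eq32_regroup (J K : ℕ) (t₀ x h : ℝ) (m : ℕ → ℤ) (u : ℤ → ℝ) :
    ∑ j ∈ Finset.Icc 1 J, (((1 / Real.sqrt (j : ℝ) : ℝ) : ℂ) * (((j : ℝ) * Real.sqrt π : ℝ) : ℂ) ^ (-(I * t₀))) *
        ∑ k ∈ Finset.range K, (((((Real.log ((j : ℝ) * Real.sqrt π) / (2 * π)) - u (m j)) ^ k / (k.factorial : ℝ) : ℝ)) : ℂ) *
          ∫ t : ℝ, Complex.Gamma ((1 / 2 + (t + t₀) * I) / 2) *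
          Complex.exp ((π * (t + t₀) / 4 - t ^ 2 / (2 * h ^ 2) : ℝ) : ℂ) * (-(2 * π * t : ℝ) * I) ^ k *
          Complex.exp (-(2 * π * t * (x + u (m j)) : ℝ) * I) =
      ∑ k ∈ Finset.range K, ∑ μ ∈ (Finset.Icc 1 J).image m,
        (∫ t : ℝ, Complex.Gamma ((1 / 2 + (t + t₀) * I) / 2) *
          Complex.exp ((π * (t + t₀) / 4 - t ^ 2 / (2 * h ^ 2) : ℝ) : ℂ) * (-(2 * π * t : ℝ) * I) ^ k *
          Complex.exp (-(2 * π * t * (x + u μ) : ℝ) * I)) / (k.factorial : ℂ) *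
          ∑ j ∈ (Finset.Icc 1 J).filter (fun j => m j = μ), (((1 / Real.sqrt (j : ℝ) : ℝ) : ℂ) * (((j : ℝ) * Real.sqrt π : ℝ) : ℂ) ^ (-(I * t₀))) * (((((Real.log ((j : ℝ) * Real.sqrt π) / (2 * π)) - u μ) ^ k : ℝ)) : ℂ) := by
  simp_rw [Finset.mul_sum]
  rw [Finset.sum_comm]
  refine Finset.sum_congr rfl fun k _ => ?_
  rw [← Finset.sum_fiberwise_of_maps_to (g := m) (t := (Finset.Icc 1 J).image m)
    (fun j hj => Finset.mem_image_of_mem m hj)]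
  refine Finset.sum_congr rfl fun μ _ => ?_
  refine Finset.sum_congr rfl fun j hj => ?_
  have hμ : m j = μ := (Finset.mem_filter.mp hj).2
  subst hμ
  generalize (∫ t : ℝ, Complex.Gamma ((1 / 2 + (t + t₀) * I) / 2) *
          Complex.exp ((π * (t + t₀) / 4 - t ^ 2 / (2 * h ^ 2) : ℝ) : ℂ) * (-(2 * π * t : ℝ) * I) ^ k *
          Complex.exp (-(2 * π * t * (x + u (m j)) : ℝ) * I)) = Gk
  push_cast
  ring

/-! ### Step (5) as used: Lemma 3.2 + Lemma B.1 + `(2√J − 1)` × Lemma B.2 -/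

open Platt2017 in
/-- **The total error of step (5) as the algorithm uses it (pp. 2453, 2463–2464), PROVED:** for
`x ≥ 0`, `h > 0`, `J ≥ 1`, any `σ > 1`, `ξ ≥ 0`, any bucketing `j ↦ m(j)` onto grid points `u_m` with
`|log(j√π)/(2π) − u_{m(j)}| ≤ ξ` for `j ≤ J`,
`|F(x) − Σ_{k<K} Σ_m G^{(k)}(x+u_m)/k! · S^{(k)}_{m,J}|
≤ 2π^{5/4} e^{1/(8h²) − t₀²/(2h²) − πx}` (Lemma 3.2)
`+ C(σ,t₀,h,0) e^{(2σ−1)²/(8h²)} π^{(1−2σ)/4} J^{1−σ}/(σ−1)` (Lemma B.1, the `j > J` tail)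
`+ (2√J − 1) 2^{(K+5)/2} π^{K+1/2} h^{K+1} ξ^K/Γ((K+2)/2)` (Lemma B.2, «`J` times, weighted by `1/√j`»),
where `S^{(k)}_{m,J} = Σ_{j ≤ J, m(j) = m} (1/√j)(j√π)^{−it₀}(log(j√π)/(2π) − u_m)^k` and `C(σ,t₀,h,0) =
∫|Γ((σ+i(t+t₀))/2)| e^{π(t+t₀)/4 − t²/(2h²)} dt` — assembled from `platt2017_lemma32`, `platt2017_lemmaB1`,
`platt2017_eq32_taylor_truncation` and `platt2017_eq32_regroup`.
[cite: Platt2017, Lemma 3.2, Lemma 3.3 / (3.2) p. 2453; Lemma B.1 p. 2463; Lemma B.2 and remark p. 2464] -/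
theorem platt2017_step5_error_budget (J K : ℕ) {σ t₀ h x ξ : ℝ} (m : ℕ → ℤ) (u : ℤ → ℝ) (hσ : 1 < σ)
    (hh : 0 < h) (hx : 0 ≤ x) (hJ : 1 ≤ J) (hξ : 0 ≤ ξ)
    (hv : ∀ j ∈ Finset.Icc 1 J, |(Real.log ((j : ℝ) * Real.sqrt π) / (2 * π)) - u (m j)| ≤ ξ) :
    ‖(∫ t : ℝ, (π : ℂ) ^ (-(I * (t + t₀ : ℝ) / 2)) * Complex.Gamma ((1 / 2 + (t + t₀ : ℝ) * I) / 2) *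
        riemannZeta (1 / 2 + (t + t₀ : ℝ) * I) *
        Complex.exp ((π * (t + t₀) / 4 - t ^ 2 / (2 * h ^ 2) : ℝ) : ℂ) *
        Complex.exp (-(2 * π * t * x : ℝ) * I)) - (∑ k ∈ Finset.range K, ∑ μ ∈ (Finset.Icc 1 J).image m,
        (∫ t : ℝ, Complex.Gamma ((1 / 2 + (t + t₀) * I) / 2) *
          Complex.exp ((π * (t + t₀) / 4 - t ^ 2 / (2 * h ^ 2) : ℝ) : ℂ) * (-(2 * π * t : ℝ) * I) ^ k *
          Complex.exp (-(2 * π * t * (x + u μ) : ℝ) * I)) / (k.factorial : ℂ) *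
          ∑ j ∈ (Finset.Icc 1 J).filter (fun j => m j = μ), (((1 / Real.sqrt (j : ℝ) : ℝ) : ℂ) * (((j : ℝ) * Real.sqrt π : ℝ) : ℂ) ^ (-(I * t₀))) * (((((Real.log ((j : ℝ) * Real.sqrt π) / (2 * π)) - u μ) ^ k : ℝ)) : ℂ))‖ ≤ 2 * π ^ (5 / 4 : ℝ) * Real.exp (1 / (8 * h ^ 2) - t₀ ^ 2 / (2 * h ^ 2) - π * x) +
        (∫ t : ℝ, ‖Complex.Gamma ((σ + (t + t₀) * I) / 2)‖ * Real.exp (π * (t + t₀) / 4 - t ^ 2 / (2 * h ^ 2))) *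
          Real.exp ((2 * σ - 1) ^ 2 / (8 * h ^ 2)) * π ^ ((1 - 2 * σ) / 4) * ((J : ℝ) ^ (1 - σ) / (σ - 1)) +
        (2 * Real.sqrt J - 1) *
          ((2 : ℝ) ^ (((K : ℝ) + 5) / 2) * π ^ ((K : ℝ) + 1 / 2) * h ^ (K + 1) * ξ ^ K /
            Real.Gamma (((K : ℝ) + 2) / 2)) := by
  obtain ⟨hS, h32⟩ := platt2017_lemma32 (t₀ := t₀) hh hx
  obtain ⟨_, hB1⟩ := platt2017_lemmaB1 (t₀ := t₀) (x := x) (J := J) hσ hh hx hJ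
  have hT := platt2017_eq32_taylor_truncation J K t₀ x (fun j => u (m j)) hJ hh hξ hv
  have hR := platt2017_eq32_regroup J K t₀ x h m u
  -- split Lemma 3.2's series at `J`
  have hsplit : (∑' n : ℕ, (((1 / Real.sqrt (n : ℝ) : ℝ) : ℂ) * (((n : ℝ) * Real.sqrt π : ℝ) : ℂ) ^ (-(I * t₀))) *
        ∫ t : ℝ, Complex.Gamma ((1 / 2 + (t + t₀) * I) / 2) *
          Complex.exp ((π * (t + t₀) / 4 - t ^ 2 / (2 * h ^ 2) : ℝ) : ℂ) *
          Complex.exp (-(2 * π * t * (x + (Real.log ((n : ℝ) * Real.sqrt π) / (2 * π))) : ℝ) * I)) = (∑ j ∈ Finset.Icc 1 J, (((1 / Real.sqrt (j : ℝ) : ℝ) : ℂ) * (((j : ℝ) * Real.sqrt π : ℝ) : ℂ) ^ (-(I * t₀))) *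
        ∫ t : ℝ, Complex.Gamma ((1 / 2 + (t + t₀) * I) / 2) *
          Complex.exp ((π * (t + t₀) / 4 - t ^ 2 / (2 * h ^ 2) : ℝ) : ℂ) *
          Complex.exp (-(2 * π * t * (x + (Real.log ((j : ℝ) * Real.sqrt π) / (2 * π))) : ℝ) * I)) + (∑' n : ℕ, (((1 / Real.sqrt ((n + J + 1 : ℕ) : ℝ) : ℝ) : ℂ) * ((((n + J + 1 : ℕ) : ℝ) * Real.sqrt π : ℝ) : ℂ) ^ (-(I * t₀))) *
        ∫ t : ℝ, Complex.Gamma ((1 / 2 + (t + t₀) * I) / 2) *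
          Complex.exp ((π * (t + t₀) / 4 - t ^ 2 / (2 * h ^ 2) : ℝ) : ℂ) *
          Complex.exp (-(2 * π * t * (x + (Real.log (((n + J + 1 : ℕ) : ℝ) * Real.sqrt π) / (2 * π))) : ℝ) * I)) := by
    rw [← hS.sum_add_tsum_nat_add (J + 1)]
    congr 1
    rw [Nat.range_succ_eq_Icc_zero, ← Finset.insert_Icc_add_one_left_eq_Icc (Nat.zero_le J),
      Finset.sum_insert (by simp)]
    simp only [Nat.cast_zero, Real.sqrt_zero, div_zero, Complex.ofReal_zero, zero_mul, zero_add]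
  -- the Taylor differences, summed
  have hD : (∑ j ∈ Finset.Icc 1 J, (((1 / Real.sqrt (j : ℝ) : ℝ) : ℂ) * (((j : ℝ) * Real.sqrt π : ℝ) : ℂ) ^ (-(I * t₀))) *
        ∫ t : ℝ, Complex.Gamma ((1 / 2 + (t + t₀) * I) / 2) *
          Complex.exp ((π * (t + t₀) / 4 - t ^ 2 / (2 * h ^ 2) : ℝ) : ℂ) *
          Complex.exp (-(2 * π * t * (x + (Real.log ((j : ℝ) * Real.sqrt π) / (2 * π))) : ℝ) * I)) - (∑ j ∈ Finset.Icc 1 J, (((1 / Real.sqrt (j : ℝ) : ℝ) : ℂ) * (((j : ℝ) * Real.sqrt π : ℝ) : ℂ) ^ (-(I * t₀))) *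
        ∑ k ∈ Finset.range K, (((((Real.log ((j : ℝ) * Real.sqrt π) / (2 * π)) - u (m j)) ^ k / (k.factorial : ℝ) : ℝ)) : ℂ) *
          ∫ t : ℝ, Complex.Gamma ((1 / 2 + (t + t₀) * I) / 2) *
          Complex.exp ((π * (t + t₀) / 4 - t ^ 2 / (2 * h ^ 2) : ℝ) : ℂ) * (-(2 * π * t : ℝ) * I) ^ k *
          Complex.exp (-(2 * π * t * (x + u (m j)) : ℝ) * I)) = (∑ j ∈ Finset.Icc 1 J, (((1 / Real.sqrt (j : ℝ) : ℝ) : ℂ) * (((j : ℝ) * Real.sqrt π : ℝ) : ℂ) ^ (-(I * t₀))) *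
        ((∫ t : ℝ, Complex.Gamma ((1 / 2 + (t + t₀) * I) / 2) *
          Complex.exp ((π * (t + t₀) / 4 - t ^ 2 / (2 * h ^ 2) : ℝ) : ℂ) *
          Complex.exp (-(2 * π * t * (x + (Real.log ((j : ℝ) * Real.sqrt π) / (2 * π))) : ℝ) * I)) -
          ∑ k ∈ Finset.range K, (((((Real.log ((j : ℝ) * Real.sqrt π) / (2 * π)) - u (m j)) ^ k / (k.factorial : ℝ) : ℝ)) : ℂ) *
            ∫ t : ℝ, Complex.Gamma ((1 / 2 + (t + t₀) * I) / 2) *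
          Complex.exp ((π * (t + t₀) / 4 - t ^ 2 / (2 * h ^ 2) : ℝ) : ℂ) * (-(2 * π * t : ℝ) * I) ^ k *
          Complex.exp (-(2 * π * t * (x + u (m j)) : ℝ) * I))) := by
    rw [← Finset.sum_sub_distrib]
    refine Finset.sum_congr rfl fun j _ => ?_
    ring
  have key : (∫ t : ℝ, (π : ℂ) ^ (-(I * (t + t₀ : ℝ) / 2)) * Complex.Gamma ((1 / 2 + (t + t₀ : ℝ) * I) / 2) *
        riemannZeta (1 / 2 + (t + t₀ : ℝ) * I) *
        Complex.exp ((π * (t + t₀) / 4 - t ^ 2 / (2 * h ^ 2) : ℝ) : ℂ) *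
        Complex.exp (-(2 * π * t * x : ℝ) * I)) - (∑ k ∈ Finset.range K, ∑ μ ∈ (Finset.Icc 1 J).image m,
        (∫ t : ℝ, Complex.Gamma ((1 / 2 + (t + t₀) * I) / 2) *
          Complex.exp ((π * (t + t₀) / 4 - t ^ 2 / (2 * h ^ 2) : ℝ) : ℂ) * (-(2 * π * t : ℝ) * I) ^ k *
          Complex.exp (-(2 * π * t * (x + u μ) : ℝ) * I)) / (k.factorial : ℂ) *
          ∑ j ∈ (Finset.Icc 1 J).filter (fun j => m j = μ), (((1 / Real.sqrt (j : ℝ) : ℝ) : ℂ) * (((j : ℝ) * Real.sqrt π : ℝ) : ℂ) ^ (-(I * t₀))) * (((((Real.log ((j : ℝ) * Real.sqrt π) / (2 * π)) - u μ) ^ k : ℝ)) : ℂ)) = ((∫ t : ℝ, (π : ℂ) ^ (-(I * (t + t₀ : ℝ) / 2)) * Complex.Gamma ((1 / 2 + (t + t₀ : ℝ) * I) / 2) *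
        riemannZeta (1 / 2 + (t + t₀ : ℝ) * I) *
        Complex.exp ((π * (t + t₀) / 4 - t ^ 2 / (2 * h ^ 2) : ℝ) : ℂ) *
        Complex.exp (-(2 * π * t * x : ℝ) * I)) - (∑' n : ℕ, (((1 / Real.sqrt (n : ℝ) : ℝ) : ℂ) * (((n : ℝ) * Real.sqrt π : ℝ) : ℂ) ^ (-(I * t₀))) *
        ∫ t : ℝ, Complex.Gamma ((1 / 2 + (t + t₀) * I) / 2) *
          Complex.exp ((π * (t + t₀) / 4 - t ^ 2 / (2 * h ^ 2) : ℝ) : ℂ) *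
          Complex.exp (-(2 * π * t * (x + (Real.log ((n : ℝ) * Real.sqrt π) / (2 * π))) : ℝ) * I))) + ((∑' n : ℕ, (((1 / Real.sqrt ((n + J + 1 : ℕ) : ℝ) : ℝ) : ℂ) * ((((n + J + 1 : ℕ) : ℝ) * Real.sqrt π : ℝ) : ℂ) ^ (-(I * t₀))) *
        ∫ t : ℝ, Complex.Gamma ((1 / 2 + (t + t₀) * I) / 2) *
          Complex.exp ((π * (t + t₀) / 4 - t ^ 2 / (2 * h ^ 2) : ℝ) : ℂ) *
          Complex.exp (-(2 * π * t * (x + (Real.log (((n + J + 1 : ℕ) : ℝ) * Real.sqrt π) / (2 * π))) : ℝ) * I)) + (∑ j ∈ Finset.Icc 1 J, (((1 / Real.sqrt (j : ℝ) : ℝ) : ℂ) * (((j : ℝ) * Real.sqrt π : ℝ) : ℂ) ^ (-(I * t₀))) *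
        ((∫ t : ℝ, Complex.Gamma ((1 / 2 + (t + t₀) * I) / 2) *
          Complex.exp ((π * (t + t₀) / 4 - t ^ 2 / (2 * h ^ 2) : ℝ) : ℂ) *
          Complex.exp (-(2 * π * t * (x + (Real.log ((j : ℝ) * Real.sqrt π) / (2 * π))) : ℝ) * I)) -
          ∑ k ∈ Finset.range K, (((((Real.log ((j : ℝ) * Real.sqrt π) / (2 * π)) - u (m j)) ^ k / (k.factorial : ℝ) : ℝ)) : ℂ) *
            ∫ t : ℝ, Complex.Gamma ((1 / 2 + (t + t₀) * I) / 2) *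
          Complex.exp ((π * (t + t₀) / 4 - t ^ 2 / (2 * h ^ 2) : ℝ) : ℂ) * (-(2 * π * t : ℝ) * I) ^ k *
          Complex.exp (-(2 * π * t * (x + u (m j)) : ℝ) * I)))) := by
    rw [← hR, ← hD, hsplit]
    ring
  rw [key]
  refine (norm_add_le _ _).trans ?_
  refine (add_le_add (le_of_eq h32) ((norm_add_le _ _).trans (add_le_add hB1 hT))).trans (le_of_eq ?_)
  ring

end Literature.NumberTheory.LFunctions
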